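import Summits.ValiantsHypothesis.ValiantsHypothesis.Theorems.NewtonUnitEquationsTwoProductsRankOneThreeLawLaw
import Summits.ValiantsHypothesis.ValiantsHypothesis.Theorems.NewtonUnitEquationsTwoProductsFormalLogLinearisationShiftRankCell

/-!
# Route NewtonUnitEquations — crux `TwoProducts` (stmt-ValiantsHypothesis-5906), line `relation_ladder`, rung R7b (three-term
# rank one, GENERAL shape `pα = qβ + rγ`, `p, q, r ≥ 1`): the lift `Y_α ↦ Y_β^q Y_γ^r, Y_β ↦ Y_β^p, Y_γ ↦ Y_γ^p` over the
# `p`-DILATED plane, DOUBLE SLICING with divisibility guards — `RankOneThreeGenLaw`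

val-idea-8 g3 (ideator; lens decomp), 2026-08-28. Generalises the R7a module (`p = 1`) and subsumes R6b `(1;1,1)`, R6c `(2;1,1)`,
R6d `(q+r; q,r)`: the substitution has fibres `{L : L_α = k, p L_β = x_β − qk, p L_γ = x_γ − rk}` (divisibility guards
`p ∣ x_β − qk`, `p ∣ x_γ − rk`) of letter count `n_k = R + B_k`, `R = Σ_{rest} x_j`, `B_k = k + (x_β − qk)/p + (x_γ − rk)/p`;
slicing BOTH coordinates `(b₁, b₂) = (x_β, x_γ)` makes `multinomial(L_k)/n_k = Pfac(x) · C(R + B_k − 1, B_k) · κ_k` EXACT with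
`Pfac = (R−1)!/∏_{rest} x_j!`, sign `(−1)^{deg L_k + 1} = (−1)^{deg x + 1} (−1)^{b₁ + b₂ + B_k}`; the slice functions have finite
SHIFT RANK and val-lit-p3's `ShiftRank.pencilCount` applies BY NAME.  The planar push-forward is DILATED by `p` (`enumP`: `Y_β ↦ β`,
`Y_γ ↦ γ`, `Y_i ↦ p·e_i`), so `φ_{enumP}(lift) = φ_{(k ↦ p e_k)}(tailDiff)` and a visible point `l` lifts over `p·l`.  Large
coefficients (`p, q` or `r > m`) and absent relation letters force permutation type (R3♯ `permTypeLaw_proof`).  REV 2: the engine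
never needs `r ≥ 1` (fields `QIdx.hr`/`RelData.hr` dropped), so `r = 0` with an idle third tail letter `γ` (`Y_γ ↦ Y_γ^p`, `enumP γ = γ`)
gives rung R7c `rankOneTwoLaw` — rank one on TWO letters with torsion `p α = q β` (`α ≠ β`); a tail alphabet inside `{α, β}` has
`#visible ≤ #tuples ≤ 3^m`.  Nothing here moves VP ≠ VNP; `TwoProducts` (5906) stays OPEN; the residual of the line stays a LAW with
0 provers. [folklore]
-/

noncomputable section

set_option linter.dupNamespace false
set_option linter.unusedSimpArgs false
set_option linter.deprecated false
set_option linter.unusedSectionVars false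
set_option linter.unusedVariables false
set_option linter.unnecessarySeqFocus false

namespace Summit.ValiantsHypothesis.ValiantsHypothesis.Theorems.NewtonUnitEquations.TwoProducts.PermutationType
namespace R7b
open scoped BigOperators
open MvPolynomial

variable {σ : Type*} [Fintype σ] [DecidableEq σ]

/-! ## Part T2: relation indices with coefficients and the substitution `Y_a ↦ Y_b^q Y_c^r`, `Y_b ↦ Y_b^p`, `Y_c ↦ Y_c^p` -/

/-- Three distinct indices and the three coefficients of the relation `p α = q β + r γ` (`p, q ≥ 1`, `r ≥ 0`; `r = 0` with an idle third
index `c` is the two-letter torsion relation `p α = q β`). [folklore] -/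
structure QIdx (σ : Type*) where
  /-- index of `α` (idle upstairs) -/
  a : σ
  /-- index of `β` (first slice coordinate) -/
  b : σ
  /-- index of `γ` (second slice coordinate) -/
  c : σ
  /-- coefficient of `β` -/
  q : ℕ
  /-- coefficient of `γ` -/
  r : ℕ
  /-- coefficient of `α` -/
  p : ℕ
  hq : 1 ≤ q
  hp : 1 ≤ p
  hab : a ≠ b
  hac : a ≠ c
  hbc : b ≠ c

variable (I : QIdx σ)

/-- The substitution on letters: `α ↦ q β + r γ`, `β ↦ p β`, `γ ↦ p γ`, all other letters unchanged. [folklore] -/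
def frM (i : σ) : σ →₀ ℕ :=
  if i = I.a then Finsupp.single I.b I.q + Finsupp.single I.c I.r
  else if i = I.b then Finsupp.single I.b I.p
  else if i = I.c then Finsupp.single I.c I.p
  else Finsupp.single i 1

theorem frM_a : frM I I.a = Finsupp.single I.b I.q + Finsupp.single I.c I.r := by
  unfold frM; rw [if_pos rfl]

theorem frM_b : frM I I.b = Finsupp.single I.b I.p := by
  unfold frM; rw [if_neg (fun h => I.hab h.symm), if_pos rfl]

theorem frM_c : frM I I.c = Finsupp.single I.c I.p := by
  unfold frM; rw [if_neg (fun h => I.hac h.symm), if_neg (fun h => I.hbc h.symm), if_pos rfl]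

theorem frM_other (i : σ) (ha : i ≠ I.a) (hb : i ≠ I.b) (hc : i ≠ I.c) : frM I i = Finsupp.single i 1 := by
  unfold frM; rw [if_neg ha, if_neg hb, if_neg hc]

theorem frM_ne_zero (i : σ) : frM I i ≠ 0 := by
  have hq := I.hq
  have hp := I.hp
  unfold frM
  split_ifs <;> intro h
  · have := DFunLike.congr_fun h I.b
    simp [Finsupp.single_apply, I.hbc, I.hbc.symm] at this
    omega
  · have := DFunLike.congr_fun h I.b; simp at this; omega
  · have := DFunLike.congr_fun h I.c; simp at this; omega
  · have := DFunLike.congr_fun h i; simp at this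

/-- The `a`-coordinate of a toric image vanishes. [folklore] -/
theorem piT_frM_a (L : σ →₀ ℕ) : piT (frM I) L I.a = 0 := by
  have F := And.intro I.hab (And.intro I.hac I.hbc)
  rw [piT_apply]
  refine Finset.sum_eq_zero fun i _ => ?_
  unfold frM
  split_ifs with h1 h2 h3 <;>
    simp [Finsupp.single_apply, h1, F.1, F.2.1, F.2.2, F.1.symm, F.2.1.symm, F.2.2.symm]

/-- The `b`-coordinate of a toric image: `q #α + p #β`. [folklore] -/
theorem piT_frM_b (L : σ →₀ ℕ) : piT (frM I) L I.b = I.q * L I.a + I.p * L I.b := by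
  have F := And.intro I.hab (And.intro I.hac I.hbc)
  rw [piT_apply]
  have key : ∀ i, L i * (frM I i) I.b = (if i = I.a then I.q * L i else 0) + (if i = I.b then I.p * L i else 0) := by
    intro i
    unfold frM
    split_ifs with h1 h2 h3 <;>
      simp [Finsupp.single_apply, F.1, F.2.1, F.2.2, F.1.symm, F.2.1.symm, F.2.2.symm] <;> simp_all <;> ring
  simp only [key, Finset.sum_add_distrib, Finset.sum_ite_eq', Finset.mem_univ, if_true]

/-- The `c`-coordinate of a toric image: `r #α + p #γ`. [folklore] -/
theorem piT_frM_c (L : σ →₀ ℕ) : piT (frM I) L I.c = I.r * L I.a + I.p * L I.c := by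
  have F := And.intro I.hab (And.intro I.hac I.hbc)
  rw [piT_apply]
  have key : ∀ i, L i * (frM I i) I.c = (if i = I.a then I.r * L i else 0) + (if i = I.c then I.p * L i else 0) := by
    intro i
    unfold frM
    split_ifs with h1 h2 h3 <;>
      simp [Finsupp.single_apply, F.1, F.2.1, F.2.2, F.1.symm, F.2.1.symm, F.2.2.symm] <;> simp_all <;> ring
  simp only [key, Finset.sum_add_distrib, Finset.sum_ite_eq', Finset.mem_univ, if_true]

/-- Other coordinates of a toric image are unchanged. [folklore] -/
theorem piT_frM_other (L : σ →₀ ℕ) (j : σ) (ha : j ≠ I.a) (hb : j ≠ I.b) (hc : j ≠ I.c) : piT (frM I) L j = L j := by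
  have F := And.intro I.hab (And.intro I.hac I.hbc)
  rw [piT_apply]
  have key : ∀ i, L i * (frM I i) j = (if i = j then L i else 0) := by
    intro i
    unfold frM
    split_ifs with h1 h2 h3 <;>
      simp [Finsupp.single_apply, ha, hb, hc, Ne.symm ha, Ne.symm hb, Ne.symm hc,
        F.1, F.2.1, F.2.2, F.1.symm, F.2.1.symm, F.2.2.symm] <;> simp_all
  simp only [key]
  rw [Finset.sum_ite_eq']; simp

/-! ## Part T3: the three special coordinates, the reduced exponent (all three zeroed), the fibres -/

/-- The three relation indices as a finset. [folklore] -/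
def threeSet : Finset σ := {I.a, I.b, I.c}

/-- The remaining indices. [folklore] -/
def rest : Finset σ := Finset.univ \ threeSet I

theorem mem_rest (j : σ) : j ∈ rest I ↔ j ≠ I.a ∧ j ≠ I.b ∧ j ≠ I.c := by
  classical
  unfold rest threeSet
  simp only [Finset.mem_sdiff, Finset.mem_univ, true_and, Finset.mem_insert, Finset.mem_singleton, not_or]

theorem prod_three_split {β : Type*} [CommMonoid β] (f : σ → β) :
    ∏ j, f j = (∏ j ∈ rest I, f j) * (f I.a * (f I.b * f I.c)) := by
  classical
  unfold rest threeSet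
  rw [← Finset.prod_sdiff (Finset.subset_univ ({I.a, I.b, I.c} : Finset σ))]
  congr 1
  rw [Finset.prod_insert (by simp [I.hab, I.hac]), Finset.prod_pair I.hbc]

theorem sum_three_split {β : Type*} [AddCommMonoid β] (f : σ → β) :
    ∑ j, f j = (∑ j ∈ rest I, f j) + (f I.a + (f I.b + f I.c)) := by
  classical
  unfold rest threeSet
  rw [← Finset.sum_sdiff (Finset.subset_univ ({I.a, I.b, I.c} : Finset σ))]
  congr 1
  rw [Finset.sum_insert (by simp [I.hab, I.hac]), Finset.sum_pair I.hbc]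

/-- The reduced exponent `x̂`: the coordinates `a, b, c` set to zero. [folklore] -/
def xhat (x : σ →₀ ℕ) : σ →₀ ℕ := ofFun fun j => if j = I.a ∨ j = I.b ∨ j = I.c then 0 else x j

theorem xhat_a (x : σ →₀ ℕ) : xhat I x I.a = 0 := by
  classical simp [xhat]

theorem xhat_b (x : σ →₀ ℕ) : xhat I x I.b = 0 := by
  classical simp [xhat]

theorem xhat_c (x : σ →₀ ℕ) : xhat I x I.c = 0 := by
  classical simp [xhat]

theorem xhat_other (x : σ →₀ ℕ) (j : σ) (ha : j ≠ I.a) (hb : j ≠ I.b) (hc : j ≠ I.c) : xhat I x j = x j := by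
  classical simp [xhat, ha, hb, hc]

theorem xhat_rest (x : σ →₀ ℕ) (j : σ) (hj : j ∈ rest I) : xhat I x j = x j := by
  rw [mem_rest] at hj; exact xhat_other I x j hj.1 hj.2.1 hj.2.2

/-- The letter multiset in the fibre over `x` with `#α = k`: `#β = (x b - q k) / p, #γ = (x c - r k) / p`. [folklore] -/
def Lof (x : σ →₀ ℕ) (k : ℕ) : σ →₀ ℕ :=
  ofFun fun j => if j = I.a then k else if j = I.b then (x I.b - I.q * k) / I.p
    else if j = I.c then (x I.c - I.r * k) / I.p else x j

theorem Lof_a (x : σ →₀ ℕ) (k : ℕ) : Lof I x k I.a = k := by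
  classical simp [Lof]

theorem Lof_b (x : σ →₀ ℕ) (k : ℕ) : Lof I x k I.b = (x I.b - I.q * k) / I.p := by
  classical simp [Lof, I.hab.symm]

theorem Lof_c (x : σ →₀ ℕ) (k : ℕ) : Lof I x k I.c = (x I.c - I.r * k) / I.p := by
  classical simp [Lof, I.hac.symm, I.hbc.symm]

theorem Lof_other (x : σ →₀ ℕ) (k : ℕ) (j : σ) (ha : j ≠ I.a) (hb : j ≠ I.b) (hc : j ≠ I.c) : Lof I x k j = x j := by
  classical simp [Lof, ha, hb, hc]

/-- Admissibility of `k = #α` in the slice `(b₁, b₂)`: `q k ≤ b₁`, `r k ≤ b₂`, `p ∣ b₁ - q k`, `p ∣ b₂ - r k`. [folklore] -/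
abbrev Adm (b₁ b₂ k : ℕ) : Prop := I.q * k ≤ b₁ ∧ I.r * k ≤ b₂ ∧ I.p ∣ b₁ - I.q * k ∧ I.p ∣ b₂ - I.r * k

/-- The admissible range of `k = #α` in the fibre over `x`. [folklore] -/
def KR (x : σ →₀ ℕ) : Finset ℕ := (Finset.range (x I.b + x I.c + 1)).filter fun k => Adm I (x I.b) (x I.c) k

theorem le_qmul (k : ℕ) : k ≤ I.q * k := Nat.le_mul_of_pos_left k I.hq

theorem mem_KR (x : σ →₀ ℕ) (k : ℕ) : k ∈ KR I x ↔ Adm I (x I.b) (x I.c) k := by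
  unfold KR
  rw [Finset.mem_filter, Finset.mem_range]
  have h1 := le_qmul I k
  constructor
  · exact fun h => h.2
  · intro h; exact ⟨by have := h.1; omega, h⟩

/-- (F1) Every preimage of `x` is an `Lof x k` with `k` admissible (and `x a = 0`). [folklore] -/
theorem eq_Lof_of_piT (L x : σ →₀ ℕ) (h : piT (frM I) L = x) :
    x I.a = 0 ∧ L I.a ∈ KR I x ∧ L = Lof I x (L I.a) := by
  have ha := piT_frM_a I L; have hb := piT_frM_b I L; have hc := piT_frM_c I L
  rw [h] at ha hb hc
  refine ⟨ha, (mem_KR I x _).2 ⟨by omega, by omega, ⟨L I.b, by omega⟩, ⟨L I.c, by omega⟩⟩, ?_⟩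
  ext j
  by_cases hja : j = I.a
  · subst hja; rw [Lof_a]
  by_cases hjb : j = I.b
  · subst hjb; rw [Lof_b, show x I.b - I.q * L I.a = I.p * L I.b by omega, Nat.mul_div_cancel_left _ I.hp]
  by_cases hjc : j = I.c
  · subst hjc; rw [Lof_c, show x I.c - I.r * L I.a = I.p * L I.c by omega, Nat.mul_div_cancel_left _ I.hp]
  rw [Lof_other I x _ j hja hjb hjc, ← h, piT_frM_other I L j hja hjb hjc]

/-- (F2) Every admissible `Lof x k` lies in the fibre over `x` (when `x a = 0`). [folklore] -/
theorem piT_Lof (x : σ →₀ ℕ) (hx : x I.a = 0) (k : ℕ) (hk : k ∈ KR I x) : piT (frM I) (Lof I x k) = x := by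
  rw [mem_KR] at hk
  ext j
  by_cases hja : j = I.a
  · subst hja; rw [piT_frM_a, hx]
  by_cases hjb : j = I.b
  · subst hjb; rw [piT_frM_b, Lof_a, Lof_b, Nat.mul_div_cancel' hk.2.2.1]; omega
  by_cases hjc : j = I.c
  · subst hjc; rw [piT_frM_c, Lof_a, Lof_c, Nat.mul_div_cancel' hk.2.2.2]; omega
  rw [piT_frM_other I _ j hja hjb hjc, Lof_other I x k j hja hjb hjc]

/-- The degree of the reduced exponent: `R = Σ_{rest} x_j`. [folklore] -/
theorem deg_xhat (x : σ →₀ ℕ) : deg (xhat I x) = ∑ j ∈ rest I, x j := by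
  rw [deg_eq_sum, sum_three_split I, xhat_a, xhat_b, xhat_c, zero_add, add_zero, add_zero]
  exact Finset.sum_congr rfl fun j hj => xhat_rest I x j hj

/-- The full degree in terms of the reduced one. [folklore] -/
theorem deg_eq_deg_xhat_add (x : σ →₀ ℕ) : deg x = deg (xhat I x) + (x I.a + (x I.b + x I.c)) := by
  rw [deg_xhat, deg_eq_sum, sum_three_split I]

/-- The letter-count excess `B_k = k + (x_b − q k)/p + (x_c − r k)/p` of the fibre element `L_k` over `R`. [folklore] -/
def Bk (b₁ b₂ k : ℕ) : ℕ := k + (b₁ - I.q * k) / I.p + (b₂ - I.r * k) / I.p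

/-- (F4) The degree along the fibre: `deg (Lof x k) = R + B_k`. [folklore] -/
theorem deg_Lof_eq (x : σ →₀ ℕ) (k : ℕ) (hk : k ∈ KR I x) :
    deg (Lof I x k) = deg (xhat I x) + Bk I (x I.b) (x I.c) k := by
  rw [deg_xhat, deg_eq_sum, sum_three_split I, Lof_a, Lof_b, Lof_c]
  have : ∑ j ∈ rest I, (Lof I x k) j = ∑ j ∈ rest I, x j := by
    refine Finset.sum_congr rfl fun j hj => ?_
    rw [mem_rest] at hj
    rw [Lof_other I x k j hj.1 hj.2.1 hj.2.2]
  rw [this]; unfold Bk; omega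

theorem Bk_le {b₁ b₂ k : ℕ} (hk : Adm I b₁ b₂ k) : Bk I b₁ b₂ k ≤ b₁ + b₂ := by
  have h1 := le_qmul I k
  have h2 := hk.1
  have d1 : (b₁ - I.q * k) / I.p ≤ b₁ - I.q * k := Nat.div_le_self _ _
  have d2 : (b₂ - I.r * k) / I.p ≤ b₂ - I.r * k := Nat.div_le_self _ _
  unfold Bk; omega

theorem Bk_pos {b₁ b₂ k : ℕ} (hk : Adm I b₁ b₂ k) (hb : 1 ≤ b₁ + b₂) : 1 ≤ Bk I b₁ b₂ k := by
  obtain ⟨-, -, h3, h4⟩ := hk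
  unfold Bk
  rcases Nat.eq_zero_or_pos k with hk0 | hk0
  · subst hk0
    simp only [mul_zero, Nat.sub_zero, zero_add] at h3 h4 ⊢
    rcases Nat.eq_zero_or_pos b₁ with hb1 | hb1
    · subst hb1
      have hd : 1 ≤ b₂ / I.p := Nat.div_pos (Nat.le_of_dvd (by omega) h4) I.hp
      rw [Nat.zero_div]; omega
    · have hd : 1 ≤ b₁ / I.p := Nat.div_pos (Nat.le_of_dvd hb1 h3) I.hp
      have hd' : 0 ≤ b₂ / I.p := Nat.zero_le _
      omega
  · have : 0 ≤ (b₁ - I.q * k) / I.p := Nat.zero_le _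
    have : 0 ≤ (b₂ - I.r * k) / I.p := Nat.zero_le _
    omega

/-- The slice normaliser `(R - 1)! / ∏_{rest} x_j!` (nonzero). [folklore] -/
def Pfac (x : σ →₀ ℕ) : ℂ :=
  (((deg (xhat I x) - 1).factorial : ℕ) : ℂ) / (((∏ j ∈ rest I, (x j).factorial : ℕ)) : ℂ)

theorem Pfac_ne_zero (x : σ →₀ ℕ) : Pfac I x ≠ 0 := by
  unfold Pfac
  refine div_ne_zero (Nat.cast_ne_zero.mpr (Nat.factorial_ne_zero _)) (Nat.cast_ne_zero.mpr ?_)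
  exact Finset.prod_ne_zero_iff.mpr fun j _ => Nat.factorial_ne_zero _

/-- The fibre constant `κ_k = B_k! / (k! ((b₁ − q k)/p)! ((b₂ − r k)/p)!)`. [folklore] -/
def kap (b₁ b₂ k : ℕ) : ℂ :=
  (((Bk I b₁ b₂ k).factorial : ℕ) : ℂ) /
    (((k.factorial * ((b₁ - I.q * k) / I.p).factorial * ((b₂ - I.r * k) / I.p).factorial : ℕ)) : ℂ)

/-- (F5) **Multinomial regrouping along the fibre** (varying letter count, double slicing):
`multinomial(L_k) = Pfac(x) · C(R + B_k − 1, B_k) · κ_k · deg(L_k)` for `R = deg x̂ ≥ 1`. [folklore] -/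
theorem multinomial_Lof_eq (x : σ →₀ ℕ) (k : ℕ) (hk : k ∈ KR I x) (h1 : 1 ≤ deg (xhat I x)) :
    ((Lof I x k).multinomial : ℂ) =
      Pfac I x * (((deg (xhat I x) + Bk I (x I.b) (x I.c) k - 1).choose (Bk I (x I.b) (x I.c) k) : ℕ) : ℂ) *
        kap I (x I.b) (x I.c) k * ((deg (Lof I x k) : ℕ) : ℂ) := by
  have hk' := (mem_KR I x k).1 hk
  have hdeg := deg_Lof_eq I x k hk
  set D := deg (xhat I x) with hD
  set B := Bk I (x I.b) (x I.c) k with hB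
  set n := deg (Lof I x k) with hn
  have sL := Nat.multinomial_spec (Finset.univ : Finset σ) (Lof I x k)
  rw [← multinomial_univ, ← deg_eq_sum] at sL
  rw [prod_three_split I, Lof_a, Lof_b, Lof_c] at sL
  have hr : ∏ j ∈ rest I, ((Lof I x k) j).factorial = ∏ j ∈ rest I, (x j).factorial := by
    refine Finset.prod_congr rfl fun j hj => ?_
    rw [mem_rest] at hj
    rw [Lof_other I x k j hj.1 hj.2.1 hj.2.2]
  rw [hr, ← hn] at sL
  -- factorial identities
  have h2 : (D + B - 1).choose B * B.factorial * (D - 1).factorial = (D + B - 1).factorial := by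
    have := Nat.choose_mul_factorial_mul_factorial (n := D + B - 1) (k := B) (by omega)
    rwa [show D + B - 1 - B = D - 1 by omega] at this
  have h3 : n.factorial = n * (D + B - 1).factorial := by
    rw [show n = (D + B - 1) + 1 by omega, Nat.factorial_succ]
  set P : ℂ := ∏ j ∈ rest I, ((((x j).factorial : ℕ)) : ℂ) with hP
  set Kd : ℂ := ((k.factorial : ℕ) : ℂ) * ((((x I.b - I.q * k) / I.p).factorial : ℕ) : ℂ) *
    ((((x I.c - I.r * k) / I.p).factorial : ℕ) : ℂ) with hKd
  have hPne : P ≠ 0 := Finset.prod_ne_zero_iff.mpr fun j _ => Nat.cast_ne_zero.mpr (Nat.factorial_ne_zero _)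
  have hKdne : Kd ≠ 0 :=
    mul_ne_zero (mul_ne_zero (Nat.cast_ne_zero.mpr (Nat.factorial_ne_zero _)) (Nat.cast_ne_zero.mpr (Nat.factorial_ne_zero _)))
      (Nat.cast_ne_zero.mpr (Nat.factorial_ne_zero _))
  have key : ((Lof I x k).multinomial : ℂ) * (P * Kd) =
      (n : ℂ) * ((((D + B - 1).choose B : ℕ) : ℂ) * ((B.factorial : ℕ) : ℂ) * (((D - 1).factorial : ℕ) : ℂ)) := by
    have e : ((((∏ j ∈ rest I, (x j).factorial) *
        (k.factorial * (((x I.b - I.q * k) / I.p).factorial * ((x I.c - I.r * k) / I.p).factorial)) *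
        (Lof I x k).multinomial : ℕ)) : ℂ) = ((n.factorial : ℕ) : ℂ) := by exact_mod_cast sL
    rw [h3, ← h2] at e
    push_cast at e
    rw [hP, hKd]
    linear_combination e
  have hPf : Pfac I x = (((D - 1).factorial : ℕ) : ℂ) / P := by
    unfold Pfac; rw [hP]; push_cast; rfl
  have hkap : kap I (x I.b) (x I.c) k = ((B.factorial : ℕ) : ℂ) / Kd := by
    unfold kap; rw [hKd, hB]; push_cast; rfl
  rw [hPf, hkap]
  calc ((Lof I x k).multinomial : ℂ) = ((Lof I x k).multinomial : ℂ) * (P * Kd) / (P * Kd) := by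
        field_simp
    _ = (n : ℂ) * ((((D + B - 1).choose B : ℕ) : ℂ) * ((B.factorial : ℕ) : ℂ) * (((D - 1).factorial : ℕ) : ℂ)) / (P * Kd) := by
        rw [key]
    _ = (((D - 1).factorial : ℕ) : ℂ) / P * ((((D + B - 1).choose B : ℕ)) : ℂ) * (((B.factorial : ℕ) : ℂ) / Kd) * (n : ℂ) := by
        field_simp

/-- Fibre sums of the free substitution: `coeff_x (φ_M H) = Σ_{k ∈ KR x} coeff_{L_k} H` (for `x a = 0`). [folklore] -/
theorem coeff_phiT_frM (H : MvPolynomial σ ℂ) (x : σ →₀ ℕ) (hx : x I.a = 0) :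
    coeff x (phiT (frM I) H) = ∑ k ∈ KR I x, coeff (Lof I x k) H := by
  classical
  rw [coeff_phiT]
  rw [← Finset.sum_filter_add_sum_filter_not (KR I x) (fun k => Lof I x k ∈ H.support)]
  rw [Finset.sum_eq_zero (s := (KR I x).filter fun k => ¬ Lof I x k ∈ H.support)
    (fun k hk => notMem_support_iff.mp (Finset.mem_filter.mp hk).2), add_zero]
  apply Finset.sum_nbij' (fun L => L I.a) (fun k => Lof I x k)
  · intro L hL
    rw [Finset.mem_filter] at hL
    obtain ⟨-, hk, hLeq⟩ := eq_Lof_of_piT I L x hL.2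
    rw [Finset.mem_filter, ← hLeq]
    exact ⟨hk, hL.1⟩
  · intro k hk
    rw [Finset.mem_filter] at hk
    rw [Finset.mem_filter]
    exact ⟨hk.2, piT_Lof I x hx k hk.1⟩
  · intro L hL
    rw [Finset.mem_filter] at hL
    exact (eq_Lof_of_piT I L x hL.2).2.2.symm
  · intro k _
    exact Lof_a I x k
  · intro L hL
    rw [Finset.mem_filter] at hL
    obtain ⟨-, -, hLeq⟩ := eq_Lof_of_piT I L x hL.2
    rw [← hLeq]

/-! ## Part T4: the slice functions `F_{b₁,b₂}` (double slicing) and THE COEFFICIENT THEOREM for the free lift of the truncated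
logarithm -/

section Slice
variable {m : ℕ}

/-- The coefficient table of a signed atom. [folklore] -/
def tab (c d : Fin m → σ → ℂ) : Fin m ⊕ Fin m → σ → ℂ := Sum.elim c d

/-- The sign of a signed atom. [folklore] -/
def sgn (m : ℕ) : Fin m ⊕ Fin m → ℂ := Sum.elim (fun _ => 1) (fun _ => -1)

theorem sum_sgn : ∑ j, sgn m j = 0 := by
  rw [Fintype.sum_sum_type]; simp [sgn]

/-- The slice indicator `[ν_a = 0] [ν_b = 0] [ν_c = 0]`. [folklore] -/
def ind (ν : σ → ℕ) : ℂ := if ν I.a = 0 ∧ ν I.b = 0 ∧ ν I.c = 0 then 1 else 0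

/-- The ADDITIVE letter-count form `λ(ν) = Σ_{j ∉ {a, b, c}} ν_j`. [folklore] -/
def lam (ν : σ → ℕ) : ℕ := ∑ j ∈ rest I, ν j

/-- The exponential factor over the untouched letters. [folklore] -/
def restProd (t : σ → ℂ) (ν : σ → ℕ) : ℂ := ∏ j ∈ rest I, t j ^ ν j

/-- The admissibility guard `[q k ≤ b₁] [r k ≤ b₂] [p ∣ b₁ - q k] [p ∣ b₂ - r k]`. [folklore] -/
def gd (b₁ b₂ k : ℕ) : ℂ := if Adm I b₁ b₂ k then 1 else 0

/-- The `ν`-independent part of the `(j, k)` term: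
`[admissible] · ± (-1)^{b₁ + b₂ + B_k} t_{ja}^k t_{jb}^{(b₁ - qk)/p} t_{jc}^{(b₂ - rk)/p} · κ_k`. [folklore] -/
def mainConst (c d : Fin m → σ → ℂ) (b₁ b₂ : ℕ) (j : Fin m ⊕ Fin m) (k : ℕ) : ℂ :=
  gd I b₁ b₂ k * (sgn m j * (-1) ^ (b₁ + b₂ + Bk I b₁ b₂ k) * tab c d j I.a ^ k * tab c d j I.b ^ ((b₁ - I.q * k) / I.p) *
    tab c d j I.c ^ ((b₂ - I.r * k) / I.p) * kap I b₁ b₂ k)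

/-- The `(j, k)` term of the slice function `F_{b₁,b₂}`: `mainConst · ∏_rest t_{je}^{ν_e} · C(λ(ν) + B_k - 1, B_k)`. [folklore] -/
def mainTerm (c d : Fin m → σ → ℂ) (b₁ b₂ : ℕ) (j : Fin m ⊕ Fin m) (k : ℕ) (ν : σ → ℕ) : ℂ :=
  mainConst I c d b₁ b₂ j k *
    (restProd I (tab c d j) ν * (((lam I ν + (Bk I b₁ b₂ k - 1)).choose (Bk I b₁ b₂ k) : ℕ) : ℂ))

/-- The correction at the exceptional point `ν = 0` of the slice (the exponent `b₁ e_β + b₂ e_γ`). [folklore] -/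
def corr (c d : Fin m → σ → ℂ) (b₁ b₂ : ℕ) (ν : σ → ℕ) : ℂ :=
  if (∀ j, ν j = 0) then
    ∑ j : Fin m ⊕ Fin m, ∑ k : Fin (b₁ + b₂ + 1), mainConst I c d b₁ b₂ j k / ((Bk I b₁ b₂ k : ℕ) : ℂ)
  else 0

/-- **The slice function** `F_{b₁,b₂}` of the free lift of the truncated logarithm. [folklore] -/
def Fsl (c d : Fin m → σ → ℂ) (b₁ b₂ : ℕ) (ν : σ → ℕ) : ℂ :=
  ind I ν * (∑ j : Fin m ⊕ Fin m, ∑ k : Fin (b₁ + b₂ + 1), mainTerm I c d b₁ b₂ j k ν) + corr I c d b₁ b₂ ν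

theorem lam_xhat (x : σ →₀ ℕ) : lam I ⇑(xhat I x) = deg (xhat I x) := by
  rw [deg_xhat]; unfold lam
  exact Finset.sum_congr rfl fun j hj => xhat_rest I x j hj

theorem restProd_xhat (t : σ → ℂ) (x : σ →₀ ℕ) : restProd I t ⇑(xhat I x) = ∏ j ∈ rest I, t j ^ x j := by
  unfold restProd
  exact Finset.prod_congr rfl fun j hj => by rw [xhat_rest I x j hj]

theorem mom_Lof (t : σ → ℂ) (x : σ →₀ ℕ) (k : ℕ) :
    mom t (Lof I x k) =
      t I.a ^ k * t I.b ^ ((x I.b - I.q * k) / I.p) * t I.c ^ ((x I.c - I.r * k) / I.p) * restProd I t ⇑(xhat I x) := by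
  unfold mom
  rw [prod_three_split I, Lof_a, Lof_b, Lof_c, restProd_xhat]
  have hr : ∏ j ∈ rest I, t j ^ (Lof I x k) j = ∏ j ∈ rest I, t j ^ x j := by
    refine Finset.prod_congr rfl fun j hj => ?_
    rw [mem_rest] at hj
    rw [Lof_other I x k j hj.1 hj.2.1 hj.2.2]
  rw [hr]; ring

theorem ind_xhat (x : σ →₀ ℕ) : ind I ⇑(xhat I x) = 1 := by
  unfold ind; rw [if_pos ⟨xhat_a I x, xhat_b I x, xhat_c I x⟩]

theorem corr_xhat (c d : Fin m → σ → ℂ) (b₁ b₂ : ℕ) (x : σ →₀ ℕ) (h1 : 1 ≤ deg (xhat I x)) :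
    corr I c d b₁ b₂ ⇑(xhat I x) = 0 := by
  unfold corr
  rw [if_neg]
  intro h
  have : xhat I x = 0 := by ext j; exact h j
  rw [this] at h1
  simp [deg] at h1

theorem choose_bridge (D B : ℕ) (h1 : 1 ≤ D) : (D + (B - 1)).choose B = (D + B - 1).choose B := by
  rcases Nat.eq_zero_or_pos B with hB | hB
  · subst hB; simp
  · congr 1; omega

theorem gd_pos {b₁ b₂ k : ℕ} (h : Adm I b₁ b₂ k) : gd I b₁ b₂ k = 1 := by
  unfold gd; rw [if_pos h]

theorem gd_neg {b₁ b₂ k : ℕ} (h : ¬ Adm I b₁ b₂ k) : gd I b₁ b₂ k = 0 := by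
  unfold gd; rw [if_neg h]

theorem mainConst_eq_zero (c d : Fin m → σ → ℂ) {b₁ b₂ k : ℕ} (h : ¬ Adm I b₁ b₂ k) (j : Fin m ⊕ Fin m) :
    mainConst I c d b₁ b₂ j k = 0 := by
  unfold mainConst; rw [gd_neg I h, zero_mul]

/-- The signed atom sum of the constants: `Σ_j mainConst_{jk} = [adm] (-1)^{(q+r+1)k} κ_k (Σ_j mom c_j L_k − Σ_j mom d_j L_k) /
restProd`-free version at a reduced point. [folklore] -/
theorem sum_mainTerm_xhat (c d : Fin m → σ → ℂ) (x : σ →₀ ℕ) (h1 : 1 ≤ deg (xhat I x)) (k : ℕ) (hk : k ∈ KR I x) :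
    ∑ j, mainTerm I c d (x I.b) (x I.c) j k ⇑(xhat I x) =
      (-1 : ℂ) ^ (x I.b + x I.c + Bk I (x I.b) (x I.c) k) *
        (((deg (xhat I x) + Bk I (x I.b) (x I.c) k - 1).choose (Bk I (x I.b) (x I.c) k) : ℕ) : ℂ) *
          kap I (x I.b) (x I.c) k * (∑ j, mom (c j) (Lof I x k) - ∑ j, mom (d j) (Lof I x k)) := by
  have hk' := (mem_KR I x k).1 hk
  rw [Fintype.sum_sum_type]
  simp only [mainTerm, mainConst, gd_pos I hk', tab, sgn, Sum.elim_inl, Sum.elim_inr, lam_xhat,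
    choose_bridge _ _ h1, mom_Lof I _ x k]
  rw [mul_sub, Finset.mul_sum, Finset.mul_sum, sub_eq_add_neg, ← Finset.sum_neg_distrib]
  congr 1
  · exact Finset.sum_congr rfl fun j _ => by ring
  · exact Finset.sum_congr rfl fun j _ => by ring

theorem sum_mainTerm_xhat_zero (c d : Fin m → σ → ℂ) (x : σ →₀ ℕ) (k : ℕ) (hk : ¬ Adm I (x I.b) (x I.c) k) :
    ∑ j, mainTerm I c d (x I.b) (x I.c) j k ⇑(xhat I x) = 0 := by
  refine Finset.sum_eq_zero fun j _ => ?_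
  unfold mainTerm; rw [mainConst_eq_zero I c d hk j, zero_mul]

/-- The slice function at a reduced point is the fibre sum. [folklore] -/
theorem Fsl_xhat_eq (c d : Fin m → σ → ℂ) (x : σ →₀ ℕ) (h1 : 1 ≤ deg (xhat I x)) :
    Fsl I c d (x I.b) (x I.c) ⇑(xhat I x) = ∑ k ∈ KR I x, (-1 : ℂ) ^ (x I.b + x I.c + Bk I (x I.b) (x I.c) k) *
        (((deg (xhat I x) + Bk I (x I.b) (x I.c) k - 1).choose (Bk I (x I.b) (x I.c) k) : ℕ) : ℂ) *
          kap I (x I.b) (x I.c) k * (∑ j, mom (c j) (Lof I x k) - ∑ j, mom (d j) (Lof I x k)) := by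
  unfold Fsl
  rw [ind_xhat, corr_xhat I c d _ _ x h1, one_mul, add_zero, Finset.sum_comm]
  rw [Fin.sum_univ_eq_sum_range (fun k => ∑ j, mainTerm I c d (x I.b) (x I.c) j k ⇑(xhat I x)) (x I.b + x I.c + 1)]
  unfold KR
  rw [Finset.sum_filter]
  refine Finset.sum_congr rfl fun k _ => ?_
  by_cases hk : Adm I (x I.b) (x I.c) k
  · rw [if_pos hk]
    exact sum_mainTerm_xhat I c d x h1 k ((mem_KR I x k).2 hk)
  · rw [if_neg hk]
    exact sum_mainTerm_xhat_zero I c d x k hk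

/-- **THE COEFFICIENT THEOREM** (double slicing). For `x` with `x_a = 0`, `R = deg x̂ ≥ 1` and `deg x ≤ R_t`:
`coeff_x φ_frM(Λ_{R_t}) = (-1)^{deg x + 1} · Pfac(x) · F_{x_b, x_c}(x̂)`. [folklore] -/
theorem coeff_free_logTrunc (c d : Fin m → σ → ℂ) (R : ℕ) (x : σ →₀ ℕ) (hx : x I.a = 0)
    (h1 : 1 ≤ deg (xhat I x)) (hR : deg x ≤ R) :
    coeff x (phiT (frM I) (logTrunc c d R)) =
      (-1 : ℂ) ^ (deg x + 1) * Pfac I x * Fsl I c d (x I.b) (x I.c) ⇑(xhat I x) := by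
  classical
  rw [coeff_phiT_frM I _ x hx]
  have hdx : deg x = deg (xhat I x) + (x I.b + x I.c) := by rw [deg_eq_deg_xhat_add I x, hx, zero_add]
  have step2 : ∀ k ∈ KR I x, coeff (Lof I x k) (logTrunc c d R) =
      (-1 : ℂ) ^ (deg x + 1) * Pfac I x * ((-1 : ℂ) ^ (x I.b + x I.c + Bk I (x I.b) (x I.c) k) *
        (((deg (xhat I x) + Bk I (x I.b) (x I.c) k - 1).choose (Bk I (x I.b) (x I.c) k) : ℕ) : ℂ) *
          kap I (x I.b) (x I.c) k * (∑ j, mom (c j) (Lof I x k) - ∑ j, mom (d j) (Lof I x k))) := by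
    intro k hk
    have hk' := (mem_KR I x k).1 hk
    have hdeg := deg_Lof_eq I x k hk
    have hBle := Bk_le I hk'
    have hdeg1 : 1 ≤ deg (Lof I x k) := by omega
    have hdegR : deg (Lof I x k) ≤ R := by omega
    rw [coeff_logTrunc c d R _ hdeg1 hdegR, multinomial_Lof_eq I x k hk h1]
    have hsign : (-1 : ℂ) ^ (deg (Lof I x k) + 1) =
        (-1) ^ (deg x + 1) * (-1) ^ (x I.b + x I.c + Bk I (x I.b) (x I.c) k) := by
      have e : deg x + 1 + (x I.b + x I.c + Bk I (x I.b) (x I.c) k) = (deg (Lof I x k) + 1) + 2 * (x I.b + x I.c) := by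
        omega
      rw [← pow_add, e, pow_add (-1 : ℂ) (deg (Lof I x k) + 1), pow_mul]
      norm_num
    have hn0 : ((deg (Lof I x k) : ℕ) : ℂ) ≠ 0 := Nat.cast_ne_zero.mpr (by omega)
    rw [hsign]
    field_simp
  rw [Finset.sum_congr rfl step2, ← Finset.mul_sum, Fsl_xhat_eq I c d x h1]

/-! ### The exceptional point of a slice (`R = 0`, i.e. `x = b₁ e_β + b₂ e_γ`) -/

theorem exc_apply (x : σ →₀ ℕ) (hx : x I.a = 0) (h0 : deg (xhat I x) = 0) (j : σ) (hjb : j ≠ I.b) (hjc : j ≠ I.c) :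
    x j = 0 := by
  have hz : xhat I x = 0 := (deg_eq_zero_iff _).mp h0
  by_cases hja : j = I.a
  · rw [hja, hx]
  · have := DFunLike.congr_fun hz j
    rwa [xhat_other I x j hja hjb hjc] at this

theorem xhat_exc_apply (x : σ →₀ ℕ) (h0 : deg (xhat I x) = 0) (j : σ) : xhat I x j = 0 := by
  rw [(deg_eq_zero_iff _).mp h0]; rfl

theorem restProd_exc (t : σ → ℂ) (x : σ →₀ ℕ) (h0 : deg (xhat I x) = 0) : restProd I t ⇑(xhat I x) = 1 := by
  unfold restProd
  exact Finset.prod_eq_one fun j _ => by rw [xhat_exc_apply I x h0 j, pow_zero]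

theorem multinomial_exc (x : σ →₀ ℕ) (hx : x I.a = 0) (h0 : deg (xhat I x) = 0) (k : ℕ) (hk : k ∈ KR I x) :
    ((Lof I x k).multinomial : ℂ) = kap I (x I.b) (x I.c) k := by
  have hdeg := deg_Lof_eq I x k hk
  rw [h0, zero_add] at hdeg
  have s := Nat.multinomial_spec (Finset.univ : Finset σ) (Lof I x k)
  rw [← multinomial_univ, ← deg_eq_sum, prod_three_split I, Lof_a, Lof_b, Lof_c, hdeg] at s
  have hr : ∏ j ∈ rest I, ((Lof I x k) j).factorial = 1 := by
    refine Finset.prod_eq_one fun j hj => ?_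
    rw [mem_rest] at hj
    rw [Lof_other I x k j hj.1 hj.2.1 hj.2.2, exc_apply I x hx h0 j hj.2.1 hj.2.2, Nat.factorial_zero]
  rw [hr, one_mul] at s
  have hKd : (((k.factorial * ((x I.b - I.q * k) / I.p).factorial * ((x I.c - I.r * k) / I.p).factorial : ℕ)) : ℂ) ≠ 0 :=
    Nat.cast_ne_zero.mpr (Nat.mul_ne_zero (Nat.mul_ne_zero (Nat.factorial_ne_zero _) (Nat.factorial_ne_zero _))
      (Nat.factorial_ne_zero _))
  unfold kap
  rw [eq_div_iff hKd]
  have e : (((k.factorial * (((x I.b - I.q * k) / I.p).factorial * ((x I.c - I.r * k) / I.p).factorial) *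
      (Lof I x k).multinomial : ℕ)) : ℂ) = (((Bk I (x I.b) (x I.c) k).factorial : ℕ) : ℂ) := by exact_mod_cast s
  push_cast at e ⊢
  linear_combination e

/-- The signed atom sum of the constants of an admissible `k`. [folklore] -/
theorem sum_mainConst (c d : Fin m → σ → ℂ) (b₁ b₂ k : ℕ) (hk : Adm I b₁ b₂ k) :
    ∑ j, mainConst I c d b₁ b₂ j k = (-1 : ℂ) ^ (b₁ + b₂ + Bk I b₁ b₂ k) * kap I b₁ b₂ k *
      (∑ j : Fin m, c j I.a ^ k * c j I.b ^ ((b₁ - I.q * k) / I.p) * c j I.c ^ ((b₂ - I.r * k) / I.p) -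
        ∑ j : Fin m, d j I.a ^ k * d j I.b ^ ((b₁ - I.q * k) / I.p) * d j I.c ^ ((b₂ - I.r * k) / I.p)) := by
  rw [Fintype.sum_sum_type]
  simp only [mainConst, gd_pos I hk, tab, sgn, Sum.elim_inl, Sum.elim_inr]
  rw [mul_sub, Finset.mul_sum, Finset.mul_sum, sub_eq_add_neg, ← Finset.sum_neg_distrib]
  congr 1
  · exact Finset.sum_congr rfl fun j _ => by ring
  · exact Finset.sum_congr rfl fun j _ => by ring

/-- The slice function at the exceptional point: only the correction survives. [folklore] -/
theorem Fsl_exc (c d : Fin m → σ → ℂ) (b₁ b₂ : ℕ) (hb : 1 ≤ b₁ + b₂) (ν : σ → ℕ) (hν : ∀ j, ν j = 0) :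
    Fsl I c d b₁ b₂ ν = ∑ j : Fin m ⊕ Fin m, ∑ k : Fin (b₁ + b₂ + 1), mainConst I c d b₁ b₂ j k / ((Bk I b₁ b₂ k : ℕ) : ℂ) := by
  have hmain : ∑ j : Fin m ⊕ Fin m, ∑ k : Fin (b₁ + b₂ + 1), mainTerm I c d b₁ b₂ j k ν = 0 := by
    refine Finset.sum_eq_zero fun j _ => Finset.sum_eq_zero fun k _ => ?_
    unfold mainTerm
    by_cases hk : Adm I b₁ b₂ k
    · have hlam : lam I ν = 0 := by unfold lam; simp [hν]
      have hB := Bk_pos I hk hb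
      rw [hlam, Nat.choose_eq_zero_of_lt (by omega)]
      simp
    · rw [mainConst_eq_zero I c d hk j, zero_mul]
  unfold Fsl
  rw [hmain, mul_zero, zero_add]
  unfold corr
  rw [if_pos hν]

/-- **THE COEFFICIENT THEOREM at the exceptional exponent** `x = b₁ e_β + b₂ e_γ ≠ 0`. [folklore] -/
theorem coeff_free_logTrunc_exc (c d : Fin m → σ → ℂ) (R : ℕ) (x : σ →₀ ℕ) (hx : x I.a = 0)
    (h0 : deg (xhat I x) = 0) (hbc : 1 ≤ x I.b + x I.c) (hR : deg x ≤ R) :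
    coeff x (phiT (frM I) (logTrunc c d R)) =
      (-1 : ℂ) ^ (x I.b + x I.c + 1) * Fsl I c d (x I.b) (x I.c) ⇑(xhat I x) := by
  classical
  rw [coeff_phiT_frM I _ x hx]
  have hdx : deg x = x I.b + x I.c := by rw [deg_eq_deg_xhat_add I x, hx, h0, zero_add, zero_add]
  have hz : ∀ j, (xhat I x) j = 0 := xhat_exc_apply I x h0
  rw [Fsl_exc I c d (x I.b) (x I.c) hbc _ hz, Finset.sum_comm, Finset.mul_sum]
  rw [Fin.sum_univ_eq_sum_range (fun k => (-1 : ℂ) ^ (x I.b + x I.c + 1) *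
    ∑ j : Fin m ⊕ Fin m, mainConst I c d (x I.b) (x I.c) j k / ((Bk I (x I.b) (x I.c) k : ℕ) : ℂ)) (x I.b + x I.c + 1)]
  unfold KR
  rw [Finset.sum_filter]
  refine Finset.sum_congr rfl fun k _ => ?_
  by_cases hk : Adm I (x I.b) (x I.c) k
  · rw [if_pos hk]
    have hkm : k ∈ KR I x := (mem_KR I x k).2 hk
    have hdeg := deg_Lof_eq I x k hkm
    rw [h0, zero_add] at hdeg
    have hB1 := Bk_pos I hk hbc
    have hBle := Bk_le I hk
    have hdeg1 : 1 ≤ deg (Lof I x k) := by omega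
    have hdegR : deg (Lof I x k) ≤ R := by omega
    rw [coeff_logTrunc c d R _ hdeg1 hdegR, multinomial_exc I x hx h0 k hkm, hdeg]
    have hsign : (-1 : ℂ) ^ (Bk I (x I.b) (x I.c) k + 1) =
        (-1) ^ (x I.b + x I.c + 1) * (-1) ^ (x I.b + x I.c + Bk I (x I.b) (x I.c) k) := by
      have e : x I.b + x I.c + 1 + (x I.b + x I.c + Bk I (x I.b) (x I.c) k) =
          (Bk I (x I.b) (x I.c) k + 1) + 2 * (x I.b + x I.c) := by omega
      rw [← pow_add, e, pow_add (-1 : ℂ) (Bk I (x I.b) (x I.c) k + 1), pow_mul]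
      norm_num
    rw [hsign, ← Finset.sum_div, sum_mainConst I c d _ _ k hk]
    simp only [mom_Lof I _ x k, restProd_exc I _ x h0, mul_one]
    ring
  · rw [if_neg hk]
    rw [Finset.sum_eq_zero (fun j _ => by rw [mainConst_eq_zero I c d hk j, zero_div]), mul_zero]

/-- **The support criterion**: `x ≠ 0` with `x_a = 0` and `deg x ≤ R` lies in the support of the free lift of `Λ_R` iff
`F_{x_b, x_c}(x̂) ≠ 0`. [folklore] -/
theorem mem_support_free_logTrunc_iff (c d : Fin m → σ → ℂ) (R : ℕ) (x : σ →₀ ℕ) (hx : x I.a = 0) (hne : x ≠ 0)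
    (hR : deg x ≤ R) :
    x ∈ (phiT (frM I) (logTrunc c d R)).support ↔ Fsl I c d (x I.b) (x I.c) ⇑(xhat I x) ≠ 0 := by
  rw [mem_support_iff]
  by_cases h1 : 1 ≤ deg (xhat I x)
  · rw [coeff_free_logTrunc I c d R x hx h1 hR]
    have hc : (-1 : ℂ) ^ (deg x + 1) * Pfac I x ≠ 0 :=
      mul_ne_zero (pow_ne_zero _ (neg_ne_zero.mpr one_ne_zero)) (Pfac_ne_zero I x)
    constructor
    · intro h hF; exact h (by rw [hF, mul_zero])
    · intro h; exact mul_ne_zero hc h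
  · have h0 : deg (xhat I x) = 0 := by omega
    have hbc : 1 ≤ x I.b + x I.c := by
      by_contra h
      apply hne
      ext j
      by_cases hjb : j = I.b
      · subst hjb; simp; omega
      by_cases hjc : j = I.c
      · subst hjc; simp; omega
      rw [exc_apply I x hx h0 j hjb hjc]; rfl
    rw [coeff_free_logTrunc_exc I c d R x hx h0 hbc hR]
    have hc : (-1 : ℂ) ^ (x I.b + x I.c + 1) ≠ 0 := pow_ne_zero _ (neg_ne_zero.mpr one_ne_zero)
    constructor
    · intro h hF; exact h (by rw [hF, mul_zero])
    · intro h; exact mul_ne_zero hc h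

/-- Non-vanishing of a slice function forces `ν_a = ν_b = ν_c = 0`. [folklore] -/
theorem shape_of_Fsl_ne_zero (c d : Fin m → σ → ℂ) (b₁ b₂ : ℕ) (ν : σ → ℕ) (h : Fsl I c d b₁ b₂ ν ≠ 0) :
    ν I.a = 0 ∧ ν I.b = 0 ∧ ν I.c = 0 := by
  by_contra hcon
  apply h
  unfold Fsl ind corr
  rw [if_neg hcon, zero_mul, zero_add, if_neg]
  intro hall
  exact hcon ⟨hall I.a, hall I.b, hall I.c⟩

/-- The slice function of the slice `(0, 0)` vanishes at the origin (equal numbers of `±` atoms). [folklore] -/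
theorem Fsl_zero_zero (c d : Fin m → σ → ℂ) (ν : σ → ℕ) (hν : ∀ j, ν j = 0) : Fsl I c d 0 0 ν = 0 := by
  have hB : Bk I 0 0 0 = 0 := by unfold Bk; simp
  have hkap : kap I 0 0 0 = 1 := by unfold kap; rw [hB]; simp
  have hgd : gd I 0 0 0 = 1 := by
    unfold gd; rw [if_pos ⟨by simp, by simp, by simp, by simp⟩]
  have hmain : ∀ j : Fin m ⊕ Fin m, ∑ k : Fin (0 + 0 + 1), mainTerm I c d 0 0 j k ν = sgn m j := by
    intro j
    rw [Fin.sum_univ_one]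
    show mainTerm I c d 0 0 j 0 ν = sgn m j
    unfold mainTerm mainConst restProd
    rw [hgd, hkap, hB]
    simp [hν]
  have hcorr : corr I c d 0 0 ν = 0 := by
    unfold corr
    rw [if_pos hν]
    have : ∀ j : Fin m ⊕ Fin m, ∑ k : Fin (0 + 0 + 1), mainConst I c d 0 0 j k / ((Bk I 0 0 k : ℕ) : ℂ) = 0 := by
      intro j
      rw [Fin.sum_univ_one]
      show mainConst I c d 0 0 j 0 / ((Bk I 0 0 0 : ℕ) : ℂ) = 0
      rw [hB]; simp
    simp only [this, Finset.sum_const_zero]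
  unfold Fsl
  rw [hcorr, add_zero]
  simp only [hmain, sum_sgn, mul_zero]

/-- The exponent with prescribed slices `(b₁, b₂)` and reduced part `ν` (`ν_a = ν_b = ν_c = 0`). [folklore] -/
def xOf (b₁ b₂ : ℕ) (ν : σ → ℕ) : σ →₀ ℕ :=
  ofFun fun j => if j = I.b then b₁ else if j = I.c then b₂ else if j = I.a then 0 else ν j

theorem xOf_b (b₁ b₂ : ℕ) (ν : σ → ℕ) : xOf I b₁ b₂ ν I.b = b₁ := by
  simp [xOf]

theorem xOf_c (b₁ b₂ : ℕ) (ν : σ → ℕ) : xOf I b₁ b₂ ν I.c = b₂ := by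
  simp [xOf, I.hbc.symm]

theorem xOf_a (b₁ b₂ : ℕ) (ν : σ → ℕ) : xOf I b₁ b₂ ν I.a = 0 := by
  simp [xOf, I.hab, I.hac]

theorem xhat_xOf (b₁ b₂ : ℕ) (ν : σ → ℕ) (ha : ν I.a = 0) (hb : ν I.b = 0) (hc : ν I.c = 0) :
    ⇑(xhat I (xOf I b₁ b₂ ν)) = ν := by
  funext j
  by_cases hja : j = I.a
  · subst hja; rw [xhat_a, ha]
  by_cases hjb : j = I.b
  · subst hjb; rw [xhat_b, hb]
  by_cases hjc : j = I.c
  · subst hjc; rw [xhat_c, hc]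
  rw [xhat_other I _ j hja hjb hjc]
  simp [xOf, hja, hjb, hjc]

theorem xOf_xhat (x : σ →₀ ℕ) (hx : x I.a = 0) : xOf I (x I.b) (x I.c) ⇑(xhat I x) = x := by
  ext j
  by_cases hjb : j = I.b
  · subst hjb; rw [xOf_b]
  by_cases hjc : j = I.c
  · subst hjc; rw [xOf_c]
  by_cases hja : j = I.a
  · subst hja; rw [xOf_a, hx]
  simp [xOf, hjb, hjc, hja, xhat_other I x j hja hjb hjc]

end Slice

/-! ## Part T5: finite SHIFT RANK of the slice functions — the hypothesis of val-lit-p3's `ShiftRank.pencilCount` -/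

section ShiftDecomp

/-- A finite shift decomposition of a function on `ℕ^σ`, indexed by `ι`. [folklore] -/
def HSD (ι : Type*) [Fintype ι] (F : (σ → ℕ) → ℂ) : Prop :=
  ∃ (col : (σ → ℕ) → ι → ℂ) (ch : ι → (σ → ℕ) → ℂ), ∀ β w : σ → ℕ, F (β + w) = ∑ i, col β i * ch i w

omit [Fintype σ] [DecidableEq σ] in
theorem HSD.mul {ι κ : Type*} [Fintype ι] [Fintype κ] {F G : (σ → ℕ) → ℂ} (hF : HSD ι F) (hG : HSD κ G) :
    HSD (ι × κ) (fun ν => F ν * G ν) := by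
  obtain ⟨col, ch, hF⟩ := hF
  obtain ⟨col', ch', hG⟩ := hG
  refine ⟨fun β p => col β p.1 * col' β p.2, fun p w => ch p.1 w * ch' p.2 w, fun β w => ?_⟩
  simp only [hF, hG, Finset.sum_mul_sum, Fintype.sum_prod_type]
  exact Finset.sum_congr rfl fun i _ => Finset.sum_congr rfl fun k _ => by ring

omit [Fintype σ] [DecidableEq σ] in
theorem HSD.mulHom {ι : Type*} [Fintype ι] {F G : (σ → ℕ) → ℂ} (hF : HSD ι F)
    (hG : ∀ β w : σ → ℕ, G (β + w) = G β * G w) : HSD ι (fun ν => F ν * G ν) := by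
  obtain ⟨col, ch, hF⟩ := hF
  refine ⟨fun β i => col β i * G β, fun i w => ch i w * G w, fun β w => ?_⟩
  simp only [hF, hG, Finset.sum_mul]
  exact Finset.sum_congr rfl fun i _ => by ring

omit [Fintype σ] [DecidableEq σ] in
theorem HSD.homMul {ι : Type*} [Fintype ι] {F G : (σ → ℕ) → ℂ} (hG : ∀ β w : σ → ℕ, G (β + w) = G β * G w)
    (hF : HSD ι F) : HSD ι (fun ν => G ν * F ν) := by
  obtain ⟨col, ch, hF⟩ := hF
  refine ⟨fun β i => G β * col β i, fun i w => G w * ch i w, fun β w => ?_⟩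
  simp only [hF, hG, Finset.mul_sum]
  exact Finset.sum_congr rfl fun i _ => by ring

omit [Fintype σ] [DecidableEq σ] in
theorem HSD.constMul {ι : Type*} [Fintype ι] {F : (σ → ℕ) → ℂ} (a : ℂ) (hF : HSD ι F) : HSD ι (fun ν => a * F ν) := by
  obtain ⟨col, ch, hF⟩ := hF
  refine ⟨fun β i => a * col β i, ch, fun β w => ?_⟩
  simp only [hF, Finset.mul_sum]
  exact Finset.sum_congr rfl fun i _ => by ring

omit [Fintype σ] [DecidableEq σ] in
theorem HSD.sum {π ι : Type*} [Fintype π] [Fintype ι] (F : π → (σ → ℕ) → ℂ) (h : ∀ p, HSD ι (F p)) :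
    HSD (π × ι) (fun ν => ∑ p, F p ν) := by
  choose col ch hcol using h
  refine ⟨fun β q => col q.1 β q.2, fun q w => ch q.1 q.2 w, fun β w => ?_⟩
  simp only [hcol, Fintype.sum_prod_type]

omit [Fintype σ] [DecidableEq σ] in
theorem HSD.add {ι κ : Type*} [Fintype ι] [Fintype κ] {F G : (σ → ℕ) → ℂ} (hF : HSD ι F) (hG : HSD κ G) :
    HSD (ι ⊕ κ) (fun ν => F ν + G ν) := by
  obtain ⟨col, ch, hF⟩ := hF
  obtain ⟨col', ch', hG⟩ := hG
  refine ⟨fun β i => Sum.elim (col β) (col' β) i, fun i w => Sum.elim (fun i => ch i w) (fun k => ch' k w) i,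
    fun β w => ?_⟩
  simp only [hF, hG, Fintype.sum_sum_type, Sum.elim_inl, Sum.elim_inr]

omit [Fintype σ] [DecidableEq σ] in
/-- Binomial characters have shift rank `k + 1` (Vandermonde; val-lit-p3's `BinExpSum.binChar_add`). [folklore] -/
theorem hsd_binChar (t : ℂ) (k b₀ : ℕ) (hk : k ≤ b₀) (i₀ : σ) :
    HSD (Fin (b₀ + 1)) (fun ν : σ → ℕ => binChar t k (ν i₀)) := by
  refine ⟨fun β p => if (p : ℕ) ≤ k then binChar t p (β i₀) else 0, fun p w => binChar t (k - p) (w i₀),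
    fun β w => ?_⟩
  have h := Summit.ValiantsHypothesis.ValiantsHypothesis.Theorems.NewtonUnitEquations.TwoProducts.FormalLogLinearisation.BinExpSum.binChar_add
    t k (β i₀) (w i₀)
  simp only [Pi.add_apply]
  unfold binChar
  rw [h, Fin.sum_univ_eq_sum_range (fun p => (if p ≤ k then ((((β i₀).choose p : ℕ) : ℂ) * t ^ (β i₀ - p)) else 0) *
      ((((w i₀).choose (k - p) : ℕ) : ℂ) * t ^ (w i₀ - (k - p)))) (b₀ + 1)]
  simp_rw [ite_mul, zero_mul]
  rw [← Finset.sum_filter]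
  congr 1
  ext p
  simp only [Finset.mem_range, Finset.mem_filter]
  omega


theorem lam_add (β w : σ → ℕ) : lam I (β + w) = lam I β + lam I w := by
  unfold lam
  simp only [Pi.add_apply, Finset.sum_add_distrib]

/-- Binomial coefficients of the additive form `λ` have shift rank `d + 1` (Vandermonde). [folklore] -/
theorem hsd_choose (e d b₀ : ℕ) (hd : d ≤ b₀) :
    HSD (Fin (b₀ + 1)) (fun ν : σ → ℕ => (((lam I ν + e).choose d : ℕ) : ℂ)) := by
  refine ⟨fun β p => if (p : ℕ) ≤ d then (((lam I β + e).choose p : ℕ) : ℂ) else 0,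
    fun p w => (((lam I w).choose (d - p) : ℕ) : ℂ), fun β w => ?_⟩
  have hnat : (lam I β + e + lam I w).choose d =
      ∑ p ∈ Finset.range (d + 1), (lam I β + e).choose p * (lam I w).choose (d - p) := by
    have h := Finset.Nat.sum_antidiagonal_eq_sum_range_succ
      (fun p q => (lam I β + e).choose p * (lam I w).choose q) d
    rw [Nat.succ_eq_add_one] at h
    rw [← h, Nat.add_choose_eq]
  simp only
  rw [lam_add, show lam I β + lam I w + e = lam I β + e + lam I w by ring, hnat]
  push_cast
  rw [Fin.sum_univ_eq_sum_range (fun p => (if p ≤ d then (((lam I β + e).choose p : ℕ) : ℂ) else 0) *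
      (((lam I w).choose (d - p) : ℕ) : ℂ)) (b₀ + 1)]
  simp_rw [ite_mul, zero_mul]
  rw [← Finset.sum_filter]
  congr 1
  ext p
  simp only [Finset.mem_range, Finset.mem_filter]
  omega

theorem restProd_add (t : σ → ℂ) (β w : σ → ℕ) : restProd I t (β + w) = restProd I t β * restProd I t w := by
  unfold restProd
  rw [← Finset.prod_mul_distrib]
  exact Finset.prod_congr rfl fun j _ => by rw [Pi.add_apply, pow_add]

theorem ind_add (β w : σ → ℕ) : ind I (β + w) = ind I β * ind I w := by
  unfold ind
  simp only [Pi.add_apply]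
  by_cases hβ : β I.a = 0 ∧ β I.b = 0 ∧ β I.c = 0 <;> by_cases hw : w I.a = 0 ∧ w I.b = 0 ∧ w I.c = 0
  · rw [if_pos hβ, if_pos hw, if_pos ⟨by omega, by omega, by omega⟩, mul_one]
  · rw [if_pos hβ, if_neg hw, if_neg (fun h => hw ⟨by omega, by omega, by omega⟩), mul_zero]
  · rw [if_neg hβ, if_neg (fun h => hβ ⟨by omega, by omega, by omega⟩), zero_mul]
  · rw [if_neg hβ, if_neg (fun h => hβ ⟨by omega, by omega, by omega⟩), zero_mul]

variable {m : ℕ}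

theorem corr_hsd (c d : Fin m → σ → ℂ) (b₁ b₂ : ℕ) : HSD Unit (corr I c d b₁ b₂) := by
  refine ⟨fun β _ => corr I c d b₁ b₂ β, fun _ w => if (∀ j, w j = 0) then 1 else 0, fun β w => ?_⟩
  rw [Fintype.sum_unique]
  dsimp only
  unfold corr
  by_cases hβ : ∀ j, β j = 0
  · by_cases hw : ∀ j, w j = 0
    · rw [if_pos hw, if_pos hβ, mul_one, if_pos]
      intro j; rw [Pi.add_apply, hβ j, hw j]
    · rw [if_neg hw, mul_zero, if_neg]
      intro h; apply hw; intro j; have := h j; rw [Pi.add_apply] at this; omega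
  · rw [if_neg hβ, zero_mul, if_neg]
    intro h; apply hβ; intro j; have := h j; rw [Pi.add_apply] at this; omega

/-- Each `(j, k)` term has shift rank `≤ b₁ + b₂ + 1`. [folklore] -/
theorem mainTerm_hsd (c d : Fin m → σ → ℂ) (b₁ b₂ : ℕ) (j : Fin m ⊕ Fin m) (k : ℕ) :
    HSD (Fin (b₁ + b₂ + 1)) (mainTerm I c d b₁ b₂ j k) := by
  by_cases hk : Adm I b₁ b₂ k
  · have h1 := hsd_choose I (Bk I b₁ b₂ k - 1) (Bk I b₁ b₂ k) (b₁ + b₂) (Bk_le I hk)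
    have h2 := HSD.homMul (restProd_add I (tab c d j)) h1
    have h3 := h2.constMul (mainConst I c d b₁ b₂ j k)
    unfold mainTerm
    exact h3
  · refine ⟨fun _ _ => 0, fun _ _ => 0, fun β w => ?_⟩
    unfold mainTerm
    rw [mainConst_eq_zero I c d hk j, zero_mul]
    simp

/-- The slice index set (`|SIdx m b₁ b₂| = 2 m (b₁ + b₂ + 1)^2 + 1`). [folklore] -/
abbrev SIdx (m b₁ b₂ : ℕ) := ((Fin m ⊕ Fin m) × (Fin (b₁ + b₂ + 1) × Fin (b₁ + b₂ + 1))) ⊕ Unit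

theorem card_SIdx (m b₁ b₂ : ℕ) : Fintype.card (SIdx m b₁ b₂) = 2 * m * (b₁ + b₂ + 1) ^ 2 + 1 := by
  simp only [SIdx, Fintype.card_sum, Fintype.card_prod, Fintype.card_fin, Fintype.card_unit]
  ring

/-- **Finite shift rank of the slice functions.** [folklore] -/
theorem Fsl_hsd (c d : Fin m → σ → ℂ) (b₁ b₂ : ℕ) : HSD (SIdx m b₁ b₂) (Fsl I c d b₁ b₂) := by
  have hmain : HSD ((Fin m ⊕ Fin m) × (Fin (b₁ + b₂ + 1) × Fin (b₁ + b₂ + 1)))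
      (fun ν => ∑ j : Fin m ⊕ Fin m, ∑ k : Fin (b₁ + b₂ + 1), mainTerm I c d b₁ b₂ j k ν) :=
    HSD.sum _ fun j => HSD.sum (fun (k : Fin (b₁ + b₂ + 1)) ν => mainTerm I c d b₁ b₂ j k ν)
      fun k => mainTerm_hsd I c d b₁ b₂ j k
  have h := (HSD.homMul (ind_add I) hmain).add (corr_hsd I c d b₁ b₂)
  unfold Fsl
  exact h

/-- The shift decomposition, unpacked. [folklore] -/
theorem Fsl_shift (c d : Fin m → σ → ℂ) (b₁ b₂ : ℕ) :
    ∃ (col : (σ → ℕ) → SIdx m b₁ b₂ → ℂ) (ch : SIdx m b₁ b₂ → (σ → ℕ) → ℂ),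
      ∀ β w : σ → ℕ, Fsl I c d b₁ b₂ (β + w) = ∑ i, col β i * ch i w :=
  Fsl_hsd I c d b₁ b₂

end ShiftDecomp

/-! ## Part T7: the planar instance — relation data `pα = qβ + rγ`, the lift of the chain, the `p`-DILATED letter push-forward
`enumP`, injectivity on the lifted support from rank-one coincidences, lifted visible points (over `p·l`), letter weights -/

section FreePlanar
open Summit.ValiantsHypothesis.ValiantsHypothesis.Theorems.NewtonUnitEquations.TwoProducts.FormalLogLinearisation
open Summit.ValiantsHypothesis.ValiantsHypothesis.Theorems.NewtonUnitEquations.TwoProducts.PlanarCell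

variable {m : ℕ}
variable (u v : Fin m → MvPolynomial (Fin 2) ℂ)

/-- **Planar three-term relation data with coefficients**: distinct tail letters `α, β, γ` with `p α = q β + r γ`,
`p, q ≥ 1`, `r ≥ 0` (`r = 0`: the two-letter torsion relation `p α = q β` with an idle third tail letter `γ`). [folklore] -/
structure RelData where
  /-- the letter `α` -/
  α : Expo
  /-- the letter `β` -/
  β : Expo
  /-- the letter `γ` -/
  γ : Expo
  /-- the coefficient of `β` -/
  q : ℕ
  /-- the coefficient of `γ` -/
  r : ℕ
  /-- the coefficient of `α` -/
  p : ℕ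
  hq : 1 ≤ q
  hp : 1 ≤ p
  hα : α ∈ tailSupport u v
  hβ : β ∈ tailSupport u v
  hγ : γ ∈ tailSupport u v
  hab : α ≠ β
  hac : α ≠ γ
  hbc : β ≠ γ
  hrel : p • α = q • β + r • γ

variable {u v}
variable (D : RelData u v)

/-- The indices and coefficients of the relation letters. [folklore] -/
def RelData.idx : QIdx (Fin (sE u v)) where
  a := idxOf u v D.α D.hα
  b := idxOf u v D.β D.hβ
  c := idxOf u v D.γ D.hγ
  q := D.q
  r := D.r
  p := D.p
  hq := D.hq
  hp := D.hp
  hab h := D.hab (by have := congrArg (enum u v) h; rwa [enum_idxOf, enum_idxOf] at this)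
  hac h := D.hac (by have := congrArg (enum u v) h; rwa [enum_idxOf, enum_idxOf] at this)
  hbc h := D.hbc (by have := congrArg (enum u v) h; rwa [enum_idxOf, enum_idxOf] at this)

theorem RelData.enum_a : enum u v D.idx.a = D.α := enum_idxOf u v _ _
theorem RelData.enum_b : enum u v D.idx.b = D.β := enum_idxOf u v _ _
theorem RelData.enum_c : enum u v D.idx.c = D.γ := enum_idxOf u v _ _
theorem RelData.idx_q : D.idx.q = D.q := rfl
theorem RelData.idx_r : D.idx.r = D.r := rfl
theorem RelData.idx_p : D.idx.p = D.p := rfl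

/-- The exponent dilation `e ↦ p e` as a monomial substitution on the plane (`X_k ↦ X_k^p`). [folklore] -/
def dilE (p : ℕ) (k : Fin 2) : Expo := Finsupp.single k p

theorem piT_dilE (p : ℕ) (e : Expo) : piT (dilE p) e = p • e := by
  ext j
  rw [piT_apply]
  unfold dilE
  rw [Finset.sum_eq_single j (fun k _ hk => by rw [Finsupp.single_apply, if_neg hk, mul_zero])
    (fun h => absurd (Finset.mem_univ j) h)]
  rw [Finsupp.single_eq_same, Finsupp.smul_apply, smul_eq_mul, Nat.mul_comm]

theorem piE_dilE (p : ℕ) (e : Expo) : piE (dilE p) e = p • e := by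
  rw [piE_eq_piT, piT_dilE]

theorem nsmul_cancel {p : ℕ} (hp : 1 ≤ p) {e e' : Expo} (h : p • e = p • e') : e = e' := by
  ext k
  have := DFunLike.congr_fun h k
  simp only [Finsupp.smul_apply, smul_eq_mul] at this
  exact Nat.eq_of_mul_eq_mul_left hp this

theorem wt_nsmul' (ξ : Fin 2 → ℝ) (n : ℕ) (e : Expo) : wt ξ (n • e) = (n : ℝ) * wt ξ e := by
  unfold wt
  simp only [Finsupp.smul_apply, smul_eq_mul, Nat.cast_mul]
  ring

/-- The `p`-DILATED planar push-forward of the new letters: `Y_b ↦ β`, `Y_c ↦ γ`, `Y_i ↦ p · enum i` otherwise. [folklore] -/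
def RelData.enumP (i : Fin (sE u v)) : Expo :=
  if i = D.idx.b then D.β else if i = D.idx.c then D.γ else D.p • enum u v i

theorem RelData.enumP_b : D.enumP D.idx.b = D.β := by
  unfold RelData.enumP; rw [if_pos rfl]

theorem RelData.enumP_c : D.enumP D.idx.c = D.γ := by
  unfold RelData.enumP; rw [if_neg (fun h => D.idx.hbc h.symm), if_pos rfl]

theorem RelData.enumP_other (i : Fin (sE u v)) (hb : i ≠ D.idx.b) (hc : i ≠ D.idx.c) : D.enumP i = D.p • enum u v i := by
  unfold RelData.enumP; rw [if_neg hb, if_neg hc]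

/-- The dilated push-forward of a substituted letter is `p` times the letter: `π_{enumP} (frM i) = p · enum i`. [folklore] -/
theorem RelData.piE_enumP_frM (i : Fin (sE u v)) : piE D.enumP (frM D.idx i) = D.p • enum u v i := by
  by_cases hia : i = D.idx.a
  · subst hia
    rw [frM_a, piE_eq_piT, piT_add, piT_single, piT_single, D.enumP_b, D.enumP_c, D.enum_a, D.hrel, D.idx_q, D.idx_r]
  by_cases hib : i = D.idx.b
  · subst hib
    rw [frM_b, piE_eq_piT, piT_single, D.enumP_b, D.enum_b, D.idx_p]
  by_cases hic : i = D.idx.c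
  · subst hic
    rw [frM_c, piE_eq_piT, piT_single, D.enumP_c, D.enum_c, D.idx_p]
  · rw [frM_other D.idx i hia hib hic, piE_eq_piT, piT_single, one_smul, D.enumP_other i hib hic]

theorem RelData.comp_eq : (fun i => piT D.enumP (frM D.idx i)) = fun i => piT (dilE D.p) (enum u v i) := by
  funext i
  rw [← piE_eq_piT, D.piE_enumP_frM, piT_dilE]

/-- On exponents: dilated push-forward ∘ substitution = `p` · letter push-forward. [folklore] -/
theorem RelData.piE_enumP_piT (L : Fin (sE u v) →₀ ℕ) : piE D.enumP (piT (frM D.idx) L) = D.p • piE (enum u v) L := by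
  rw [piE_eq_piT, piE_eq_piT, piT_piT, D.comp_eq, ← piT_piT, piT_dilE]

/-- On polynomials: dilated push-forward ∘ substitution = dilation ∘ letter push-forward. [folklore] -/
theorem RelData.phi_enumP_phiT (H : MvPolynomial (Fin (sE u v)) ℂ) :
    phi D.enumP (phiT (frM D.idx) H) = phi (dilE D.p) (phi (enum u v) H) := by
  rw [phi_eq_phiT, phi_eq_phiT, phi_eq_phiT, phiT_phiT, D.comp_eq, ← phiT_phiT]

/-- The lift of the chain difference. [folklore] -/
def RelData.GT : MvPolynomial (Fin (sE u v)) ℂ := phiT (frM D.idx) (liftG (cU u v) (cV u v))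

/-- Its dilated push-forward is the `p`-dilation of the planar difference of products. [folklore] -/
theorem RelData.phi_GT : phi D.enumP D.GT = phi (dilE D.p) (tailDiff u v) := by
  unfold RelData.GT
  rw [D.phi_enumP_phiT, phi_liftG]

theorem RelData.exists_of_mem_support_GT (x : Fin (sE u v) →₀ ℕ) (hx : x ∈ D.GT.support) :
    ∃ L ∈ (liftG (cU u v) (cV u v)).support, piT (frM D.idx) L = x :=
  exists_of_mem_support_phiT (frM D.idx) _ x hx

theorem RelData.apply_a_of_mem_support_GT (x : Fin (sE u v) →₀ ℕ) (hx : x ∈ D.GT.support) : x D.idx.a = 0 := by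
  obtain ⟨L, -, rfl⟩ := D.exists_of_mem_support_GT x hx
  exact piT_frM_a D.idx L

/-- **Injectivity from rank-one coincidences** (shape `pα = qβ + rγ`), for the dilated push-forward. [folklore] -/
theorem RelData.injOn_of_rankOne (hu : ∀ j, coeff 0 (u j) = 0) (hv : ∀ j, coeff 0 (v j) = 0)
    (hR : RankOneCoincidences (fun j => (u j).support ∪ (v j).support)
      (Finsupp.single D.β D.q + Finsupp.single D.γ D.r) (Finsupp.single D.α D.p)) :
    Set.InjOn (piE D.enumP) ↑D.GT.support := by
  classical
  set A : Fin m → Finset Expo := fun j => (u j).support ∪ (v j).support with hA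
  have hcU : ∀ j i, cU u v j i ≠ 0 → enum u v i ∈ A j := fun j i h =>
    Finset.mem_union_left _ (mem_support_iff.mpr h)
  have hcV : ∀ j i, cV u v j i ≠ 0 → enum u v i ∈ A j := fun j i h =>
    Finset.mem_union_right _ (mem_support_iff.mpr h)
  have key : ∀ κ ∈ (liftG (cU u v) (cV u v)).support,
      ∃ a ∈ tuples A, ∑ j, a j = piE (enum u v) κ ∧ msetT a = Finsupp.mapDomain (enum u v) κ := by
    intro κ hκ
    unfold liftG at hκ
    rcases Finset.mem_union.1 (support_sub _ _ _ hκ) with h | h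
    · exact tuple_of_mem_support_prod u v hu hv A (cU u v) hcU κ h
    · exact tuple_of_mem_support_prod u v hu hv A (cV u v) hcV κ h
  set ρp : Fin (sE u v) →₀ ℕ := Finsupp.single D.idx.b D.q + Finsupp.single D.idx.c D.r with hρp
  set ρm : Fin (sE u v) →₀ ℕ := Finsupp.single D.idx.a D.p with hρm
  have hmp : Finsupp.mapDomain (enum u v) ρp = Finsupp.single D.β D.q + Finsupp.single D.γ D.r := by
    rw [hρp, Finsupp.mapDomain_add, Finsupp.mapDomain_single, Finsupp.mapDomain_single, D.enum_b, D.enum_c]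
  have hmm : Finsupp.mapDomain (enum u v) ρm = Finsupp.single D.α D.p := by
    rw [hρm, Finsupp.mapDomain_single, D.enum_a]
  have hπρ : piT (frM D.idx) ρp = piT (frM D.idx) ρm := by
    rw [hρp, hρm, piT_add, piT_single, piT_single, piT_single, frM_b, frM_c, frM_a, D.idx_q, D.idx_r, D.idx_p,
      smul_add, Finsupp.smul_single, Finsupp.smul_single, Finsupp.smul_single, Finsupp.smul_single]
    simp only [smul_eq_mul]
    rw [Nat.mul_comm D.q D.p, Nat.mul_comm D.r D.p]
  have hmapk : ∀ (k : ℕ) (L ρ : Fin (sE u v) →₀ ℕ),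
      Finsupp.mapDomain (enum u v) (L + k • ρ) = Finsupp.mapDomain (enum u v) L + k • Finsupp.mapDomain (enum u v) ρ := by
    intro k L ρ
    rw [Finsupp.mapDomain_add]
    congr 1
    exact map_nsmul (Finsupp.mapDomain.addMonoidHom (enum u v)) k ρ
  have cancel : ∀ (k : ℕ) (L L' : Fin (sE u v) →₀ ℕ), L + k • ρp = L' + k • ρm →
      piT (frM D.idx) L = piT (frM D.idx) L' := by
    intro k L L' h
    have := congrArg (piT (frM D.idx)) h
    rw [piT_add, piT_add, piT_nsmul, piT_nsmul, hπρ] at this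
    exact add_right_cancel this
  intro x hx x' hx' hπ
  obtain ⟨L, hL, rfl⟩ := D.exists_of_mem_support_GT x hx
  obtain ⟨L', hL', rfl⟩ := D.exists_of_mem_support_GT x' hx'
  rw [D.piE_enumP_piT, D.piE_enumP_piT] at hπ
  replace hπ := nsmul_cancel D.hp hπ
  obtain ⟨a, ha, haS, haM⟩ := key L hL
  obtain ⟨b, hb, hbS, hbM⟩ := key L' hL'
  obtain ⟨k, hk⟩ := hR a ha b hb (by rw [haS, hbS]; exact hπ)
  rw [haM, hbM, ← hmp, ← hmm, ← hmapk, ← hmapk, ← hmapk, ← hmapk] at hk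
  rcases hk with hk | hk
  · exact cancel k L L' (Finsupp.mapDomain_injective (enum_injective u v) hk)
  · exact (cancel k L' L (Finsupp.mapDomain_injective (enum_injective u v) hk)).symm

/-- Visible points lift (over `p · l`) to strict `ξ`-maxima of the lifted support (under injectivity). [folklore] -/
theorem RelData.lifted_of_visible (hinj : Set.InjOn (piE D.enumP) ↑D.GT.support) (ξ : Fin 2 → ℝ) (l : Expo)
    (htop : IsStrictTop ξ ↑(tailDiff u v).support l) :
    ∃ x₀ : Fin (sE u v) →₀ ℕ, x₀ ∈ D.GT.support ∧ piE D.enumP x₀ = D.p • l ∧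
      ∀ x ∈ D.GT.support, x ≠ x₀ → wt ξ (piE D.enumP x) < wt ξ (D.p • l) := by
  have hsupp : phi D.enumP D.GT = phi (dilE D.p) (tailDiff u v) := D.phi_GT
  have hinjD : Set.InjOn (piE (dilE D.p)) ↑(tailDiff u v).support := fun e _ e' _ h => by
    rw [piE_dilE, piE_dilE] at h; exact nsmul_cancel D.hp h
  obtain ⟨hl, hlt⟩ := htop
  have hl' : D.p • l ∈ (phi D.enumP D.GT).support := by
    rw [hsupp, mem_support_iff, ← piE_dilE D.p l, coeff_phi_of_injOn (dilE D.p) _ hinjD l hl]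
    exact mem_support_iff.mp hl
  obtain ⟨x₀, hx₀, hπ⟩ := exists_of_mem_support_phi D.enumP _ _ hl'
  refine ⟨x₀, hx₀, hπ, fun x hx hne => ?_⟩
  have hmem : piE D.enumP x ∈ (phi (dilE D.p) (tailDiff u v)).support := by
    rw [← hsupp, mem_support_iff, coeff_phi_of_injOn D.enumP _ hinj x hx]
    exact mem_support_iff.mp hx
  obtain ⟨e, he, hπe⟩ := exists_of_mem_support_phi (dilE D.p) _ _ hmem
  rw [piE_dilE] at hπe
  have hne' : e ≠ l := by
    intro h; apply hne; apply hinj hx hx₀; rw [← hπe, h, hπ]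
  have h1 := hlt e he hne'
  rw [← hπe, wt_nsmul', wt_nsmul']
  have hp : (0 : ℝ) < D.p := by exact_mod_cast D.hp
  exact mul_lt_mul_of_pos_left h1 hp

/-! ### The upstairs weights: the (dilated) letter weights themselves -/

/-- Letter weights `r_i = -wt ξ (enumP i) > 0`. [folklore] -/
def RelData.rWP (ξ : Fin 2 → ℝ) (i : Fin (sE u v)) : ℝ := -wt ξ (D.enumP i)

theorem RelData.rWP_pos (ξ : Fin 2 → ℝ) (hval : ValidWeight u v ξ) (i : Fin (sE u v)) : 0 < D.rWP ξ i := by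
  unfold RelData.rWP
  by_cases hib : i = D.idx.b
  · subst hib; rw [D.enumP_b, ← D.enum_b]; linarith [wt_enum_neg u v ξ hval D.idx.b]
  by_cases hic : i = D.idx.c
  · subst hic; rw [D.enumP_c, ← D.enum_c]; linarith [wt_enum_neg u v ξ hval D.idx.c]
  rw [D.enumP_other i hib hic, wt_nsmul']
  have h1 := wt_enum_neg u v ξ hval i
  have hp : (1 : ℝ) ≤ D.p := by exact_mod_cast D.hp
  nlinarith

/-- The letter weight functional is minus the planar weight of the dilated push-forward. [folklore] -/
theorem RelData.lwt_rWP (ξ : Fin 2 → ℝ) (x : Fin (sE u v) →₀ ℕ) : lwt (D.rWP ξ) x = -wt ξ (piE D.enumP x) :=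
  lwt_eq_neg_wt ξ D.enumP x

/-- Splitting a linear weight along the slices: `θ(x) = Σ_i θ_i x̂_i + θ_b x_b + θ_c x_c` for `x_a = 0`. [folklore] -/
theorem lwt_split (I : QIdx σ) (θ : σ → ℝ) (x : σ →₀ ℕ) (hx : x I.a = 0) :
    lwt θ x = (∑ i, θ i * ((xhat I x i : ℕ) : ℝ)) + θ I.b * ((x I.b : ℕ) : ℝ) + θ I.c * ((x I.c : ℕ) : ℝ) := by
  unfold lwt
  rw [sum_three_split I, sum_three_split I (fun i => θ i * ((xhat I x i : ℕ) : ℝ)), xhat_a, xhat_b, xhat_c, hx]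
  have hr : ∑ i ∈ rest I, θ i * ((x i : ℕ) : ℝ) = ∑ i ∈ rest I, θ i * ((xhat I x i : ℕ) : ℝ) := by
    refine Finset.sum_congr rfl fun j hj => ?_
    rw [xhat_rest I x j hj]
  rw [hr]
  push_cast
  ring

end FreePlanar

/-! ## Part T8: per visible point a zero-avoiding strict pencil-minimiser of a slice function; the fibrewise count over the
slice pairs `(b₁, b₂)` via val-lit-p3's `ShiftRank.pencilCount`; large / absent coefficients are permutation type; the arithmetic;
the law -/

section FreeCount
open Summit.ValiantsHypothesis.ValiantsHypothesis.Theorems.NewtonUnitEquations.TwoProducts.FormalLogLinearisation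
open Summit.ValiantsHypothesis.ValiantsHypothesis.Theorems.NewtonUnitEquations.TwoProducts.PlanarCell

variable {m : ℕ} {u v : Fin m → MvPolynomial (Fin 2) ℂ} (D : RelData u v)

/-- **Per visible point.** A visible point `l` (valid `ξ`) yields a toric point `x₀` over `p · l` (`x₀(a) = 0`) with slice
coordinates `(x₀(b), x₀(c)) ≤ (q m + p m, r m + p m)`, whose reduced exponent `x̂₀` is a zero-avoiding STRICT minimiser of the
letter-weight functional on `{ν : F_{x₀(b), x₀(c)}(ν) ≠ 0}` over ALL of `ℕ^s`. [folklore] -/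
theorem RelData.sliceMin_of_visible (hu : ∀ j, coeff 0 (u j) = 0) (hv : ∀ j, coeff 0 (v j) = 0)
    (hinj : Set.InjOn (piE D.enumP) ↑D.GT.support) (ξ : Fin 2 → ℝ) (hval : ValidWeight u v ξ) (l : Expo)
    (htop : IsStrictTop ξ ↑(tailDiff u v).support l) :
    ∃ x₀ : Fin (sE u v) →₀ ℕ, piE D.enumP x₀ = D.p • l ∧ x₀ D.idx.a = 0 ∧ x₀ D.idx.b ≤ D.q * m + D.p * m ∧
      x₀ D.idx.c ≤ D.r * m + D.p * m ∧
      Fsl D.idx (cU u v) (cV u v) (x₀ D.idx.b) (x₀ D.idx.c) (xhat D.idx x₀) ≠ 0 ∧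
      ∀ ν : Fin (sE u v) → ℕ, ν ≠ ⇑(xhat D.idx x₀) → Fsl D.idx (cU u v) (cV u v) (x₀ D.idx.b) (x₀ D.idx.c) ν ≠ 0 →
        ∑ i, D.rWP ξ i * ((xhat D.idx x₀ i : ℕ) : ℝ) < ∑ i, D.rWP ξ i * (ν i : ℝ) := by
  classical
  have _hu := hu; have _hv := hv
  obtain ⟨x₀, hx₀, hπ, hmin⟩ := D.lifted_of_visible hinj ξ l htop
  obtain ⟨L₀, hL₀, hx₀L⟩ := D.exists_of_mem_support_GT x₀ hx₀
  have hx₀a : x₀ D.idx.a = 0 := D.apply_a_of_mem_support_GT x₀ hx₀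
  have hdegL : deg L₀ ≤ m := deg_le_of_mem_support_liftG _ _ L₀ hL₀
  have hsumL := deg_eq_sum L₀
  rw [sum_three_split D.idx] at hsumL
  have hLa : L₀ D.idx.a ≤ m := by omega
  have hLb : L₀ D.idx.b ≤ m := by omega
  have hLc : L₀ D.idx.c ≤ m := by omega
  have hb_le : x₀ D.idx.b ≤ D.q * m + D.p * m := by
    rw [← hx₀L, piT_frM_b, D.idx_q, D.idx_p]
    have hqa : D.q * L₀ D.idx.a ≤ D.q * m := Nat.mul_le_mul_left _ hLa
    have hpb : D.p * L₀ D.idx.b ≤ D.p * m := Nat.mul_le_mul_left _ hLb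
    omega
  have hc_le : x₀ D.idx.c ≤ D.r * m + D.p * m := by
    rw [← hx₀L, piT_frM_c, D.idx_r, D.idx_p]
    have hra : D.r * L₀ D.idx.a ≤ D.r * m := Nat.mul_le_mul_left _ hLa
    have hpc : D.p * L₀ D.idx.c ≤ D.p * m := Nat.mul_le_mul_left _ hLc
    omega
  -- the upstairs weights and their normalisation
  set θ : Fin (sE u v) → ℝ := D.rWP ξ with hθdef
  have hθpos : ∀ i, 0 < θ i := D.rWP_pos ξ hval
  have hne : (Finset.univ : Finset (Fin (sE u v))).Nonempty := ⟨D.idx.a, Finset.mem_univ _⟩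
  set θmin : ℝ := Finset.univ.inf' hne θ with hθmin
  have hθmin_pos : 0 < θmin := by
    obtain ⟨i, -, hi⟩ := Finset.exists_mem_eq_inf' hne θ
    rw [hθmin, hi]; exact hθpos i
  have hθmin_le : ∀ i, θmin ≤ θ i := fun i => Finset.inf'_le θ (Finset.mem_univ i)
  set θ' : Fin (sE u v) → ℝ := fun i => θ i / θmin with hθ'
  have hθ'1 : ∀ i, 1 ≤ θ' i := fun i => by
    rw [hθ']; simp only; rw [le_div_iff₀ hθmin_pos, one_mul]; exact hθmin_le i
  have hlwt' : ∀ x : Fin (sE u v) →₀ ℕ, lwt θ' x = lwt θ x / θmin := fun x => by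
    unfold lwt; rw [Finset.sum_div]
    refine Finset.sum_congr rfl fun i _ => ?_
    rw [hθ']; ring
  have hlwtG : ∀ x ∈ D.GT.support, lwt θ x = -wt ξ (piE D.enumP x) := fun x _ => D.lwt_rWP ξ x
  have hminθ' : x₀ ∈ (phiT (frM D.idx) (liftG (cU u v) (cV u v))).support ∧
      ∀ x ∈ (phiT (frM D.idx) (liftG (cU u v) (cV u v))).support, x ≠ x₀ → lwt θ' x₀ < lwt θ' x := by
    refine ⟨hx₀, fun x hx hne' => ?_⟩
    rw [hlwt', hlwt']
    apply div_lt_div_of_pos_right _ hθmin_pos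
    rw [hlwtG x₀ hx₀, hlwtG x hx, hπ]
    linarith [hmin x hx hne']
  have hA := toric_minLog (frM D.idx) (frM_ne_zero D.idx) θ' hθ'1 (cU u v) (cV u v) x₀ hminθ'
  set R : ℕ := ⌊lwt θ' x₀⌋₊ + 1 with hRdef
  have hRlt : lwt θ' x₀ < R := by rw [hRdef]; push_cast; exact Nat.lt_floor_add_one _
  -- `x₀ ≠ 0` and `deg x₀ ≤ R`
  have hx₀ne : x₀ ≠ 0 := by
    intro h0
    have := mem_support_iff.mp hx₀
    apply this
    rw [h0]
    unfold RelData.GT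
    rw [phiT_liftG, coeff_sub,
      coeff_zero_prod_eq_one _ (fun j => coeff_zero_one_add_phiT_lin (frM D.idx) (frM_ne_zero D.idx) _),
      coeff_zero_prod_eq_one _ (fun j => coeff_zero_one_add_phiT_lin (frM D.idx) (frM_ne_zero D.idx) _), sub_self]
  have hdegR : deg x₀ ≤ R := by
    have h2 : (deg x₀ : ℝ) ≤ lwt θ' x₀ := deg_le_lwt θ' hθ'1 x₀
    have h3 : (deg x₀ : ℝ) < R := lt_of_le_of_lt h2 hRlt
    have h4 : deg x₀ < R := by exact_mod_cast h3
    omega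
  have hF0 : Fsl D.idx (cU u v) (cV u v) (x₀ D.idx.b) (x₀ D.idx.c) (xhat D.idx x₀) ≠ 0 :=
    (mem_support_free_logTrunc_iff D.idx (cU u v) (cV u v) R x₀ hx₀a hx₀ne hdegR).mp hA.1
  refine ⟨x₀, hπ, hx₀a, hb_le, hc_le, hF0, fun ν hν hFν => ?_⟩
  obtain ⟨hνa, hνb, hνc⟩ := shape_of_Fsl_ne_zero D.idx (cU u v) (cV u v) _ _ ν hFν
  set x' : Fin (sE u v) →₀ ℕ := xOf D.idx (x₀ D.idx.b) (x₀ D.idx.c) ν with hx'def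
  have hx'a : x' D.idx.a = 0 := xOf_a D.idx _ _ ν
  have hxh' : ⇑(xhat D.idx x') = ν := xhat_xOf D.idx _ _ ν hνa hνb hνc
  have hx'b : x' D.idx.b = x₀ D.idx.b := xOf_b D.idx _ _ ν
  have hx'c : x' D.idx.c = x₀ D.idx.c := xOf_c D.idx _ _ ν
  have hne' : x' ≠ x₀ := by
    intro h; apply hν; rw [← hxh', h]
  have hx'ne : x' ≠ 0 := by
    intro hz
    have hνz : ∀ j, ν j = 0 := fun j => by rw [← hxh', hz]; simp [xhat]
    have hb0 : x₀ D.idx.b = 0 := by rw [← hx'b, hz]; rfl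
    have hc0 : x₀ D.idx.c = 0 := by rw [← hx'c, hz]; rfl
    apply hFν
    rw [hb0, hc0]; exact Fsl_zero_zero D.idx (cU u v) (cV u v) ν hνz
  have hlt' : lwt θ' x₀ < lwt θ' x' := by
    by_cases hR' : deg x' ≤ R
    · have hmem : x' ∈ (phiT (frM D.idx) (logTrunc (cU u v) (cV u v) R)).support :=
        (mem_support_free_logTrunc_iff D.idx (cU u v) (cV u v) R x' hx'a hx'ne hR').mpr
          (by rw [hx'b, hx'c, hxh']; exact hFν)
      exact hA.2 x' hmem hne'
    · push Not at hR'
      have h2 : (deg x' : ℝ) ≤ lwt θ' x' := deg_le_lwt θ' hθ'1 x'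
      have h3 : (R : ℝ) < deg x' := by exact_mod_cast hR'
      linarith
  have hlt : lwt θ x₀ < lwt θ x' := by
    have := hlt'
    rw [hlwt', hlwt'] at this
    exact (div_lt_div_iff_of_pos_right hθmin_pos).mp this
  rw [lwt_split D.idx θ x₀ hx₀a, lwt_split D.idx θ x' hx'a, hx'b, hx'c] at hlt
  rw [hxh'] at hlt
  linarith

/-- The uniform width surrogate `N_m = 2 m (4 m² + 1)^2 + 1 ≥ |SIdx m b₁ b₂|` (`b₁, b₂ ≤ 2 m²`). [folklore] -/
def Nm8 (m : ℕ) : ℕ := 2 * m * (4 * (m * m) + 1) ^ 2 + 1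

/-- The slice bound, uniform in `b₁, b₂ ≤ 2 m²`. [folklore] -/
def sliceBd8 (m s : ℕ) : ℕ := (s + 2) ^ 3 * (Nm8 m + 2) ^ (3 * (Nat.log 2 (Nm8 m + 2) + 1))

/-- Monotonicity of the tool-shaped bound in the width. [folklore] -/
theorem toolBound_mono (s A : ℕ) {N N' : ℕ} (h : N ≤ N') :
    (s + 2) ^ A * (N + 2) ^ (A * (Nat.log 2 (N + 2) + 1)) ≤ (s + 2) ^ A * (N' + 2) ^ (A * (Nat.log 2 (N' + 2) + 1)) := by
  refine Nat.mul_le_mul_left _ ?_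
  calc (N + 2) ^ (A * (Nat.log 2 (N + 2) + 1)) ≤ (N' + 2) ^ (A * (Nat.log 2 (N + 2) + 1)) :=
        Nat.pow_le_pow_left (by omega) _
    _ ≤ (N' + 2) ^ (A * (Nat.log 2 (N' + 2) + 1)) :=
        Nat.pow_le_pow_right (by omega) (Nat.mul_le_mul_left _ (by
          have := Nat.log_mono_right (b := 2) (show N + 2 ≤ N' + 2 by omega); omega))

/-- **The per-slice count** from finite shift rank (val-lit-p3's `ShiftRank.pencilCount`, BY NAME). [folklore] -/
theorem sliceCount (b₁ b₂ : ℕ) (hb : b₁ + b₂ ≤ 4 * (m * m)) (U V : Fin (sE u v) → ℝ) (Sb : Finset (Fin (sE u v) → ℕ))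
    (hhyp : ∀ μ ∈ Sb, Fsl D.idx (cU u v) (cV u v) b₁ b₂ μ ≠ 0 ∧ ∃ t : ℝ, ∀ ν : Fin (sE u v) → ℕ, ν ≠ μ →
      Fsl D.idx (cU u v) (cV u v) b₁ b₂ ν ≠ 0 → ∑ i, (U i + t * V i) * (μ i : ℝ) < ∑ i, (U i + t * V i) * (ν i : ℝ)) :
    Sb.card ≤ sliceBd8 m (sE u v) := by
  obtain ⟨col, ch, hF⟩ := Fsl_shift D.idx (cU u v) (cV u v) b₁ b₂
  have h1 := ShiftRank.pencilCount hF U V Sb hhyp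
  rw [card_SIdx] at h1
  have h2 := BinExpSum.pencilCount_arith (sE u v) (2 * m * (b₁ + b₂ + 1) ^ 2 + 1)
  have h3 : 2 * m * (b₁ + b₂ + 1) ^ 2 + 1 ≤ Nm8 m :=
    Nat.add_le_add_right (Nat.mul_le_mul_left _ (Nat.pow_le_pow_left (by omega) 2)) 1
  exact h1.trans (h2.trans (toolBound_mono (sE u v) 3 h3))

/-- **The count for a non-degenerate relation** `pα = qβ + rγ` (all three letters in the alphabet, `p, q, r ≤ m`). [folklore] -/
theorem RelData.count (hu : ∀ j, coeff 0 (u j) = 0) (hv : ∀ j, coeff 0 (v j) = 0) (hqm : D.q ≤ m) (hrm : D.r ≤ m)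
    (hpm : D.p ≤ m)
    (hR : RankOneCoincidences (fun j => (u j).support ∪ (v j).support)
      (Finsupp.single D.β D.q + Finsupp.single D.γ D.r) (Finsupp.single D.α D.p))
    (S : Finset Expo) (hS : ∀ l ∈ S, ∃ ξ : Fin 2 → ℝ, ValidWeight u v ξ ∧ IsStrictTop ξ ↑(tailDiff u v).support l) :
    S.card ≤ (2 * (m * m) + 1) * (2 * (m * m) + 1) * sliceBd8 m (sE u v) := by
  classical
  rcases S.eq_empty_or_nonempty with hSe | hSne
  · simp [hSe]
  obtain ⟨l₀, hl₀⟩ := hSne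
  obtain ⟨ξ₀, hval₀, htop₀⟩ := hS l₀ hl₀
  have hTne : (tailSupport u v).Nonempty := tailSupport_nonempty_of_mem u v l₀ htop₀.1
  have hsE : 0 < sE u v := Finset.card_pos.mpr hTne
  set e₀ : Expo := enum u v ⟨0, hsE⟩ with he₀def
  have he₀ : e₀ ≠ 0 := enum_ne_zero u v hu hv _
  obtain ⟨β, τ, hpencil⟩ := pencil_param e₀ he₀
  have hinj := D.injOn_of_rankOne hu hv hR
  have hqmm : D.q * m ≤ m * m := Nat.mul_le_mul_right m hqm
  have hrmm : D.r * m ≤ m * m := Nat.mul_le_mul_right m hrm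
  have hpmm : D.p * m ≤ m * m := Nat.mul_le_mul_right m hpm
  -- choices along `S`
  have hξ : ∀ x : ↥S, ∃ ξ : Fin 2 → ℝ, ValidWeight u v ξ ∧ IsStrictTop ξ ↑(tailDiff u v).support x.1 :=
    fun x => hS x.1 x.2
  choose ξf hξval hξtop using hξ
  have hpt : ∀ x : ↥S, ∃ x₀ : Fin (sE u v) →₀ ℕ, piE D.enumP x₀ = D.p • x.1 ∧ x₀ D.idx.a = 0 ∧
      x₀ D.idx.b ≤ D.q * m + D.p * m ∧ x₀ D.idx.c ≤ D.r * m + D.p * m ∧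
      Fsl D.idx (cU u v) (cV u v) (x₀ D.idx.b) (x₀ D.idx.c) (xhat D.idx x₀) ≠ 0 ∧
      ∀ ν : Fin (sE u v) → ℕ, ν ≠ ⇑(xhat D.idx x₀) → Fsl D.idx (cU u v) (cV u v) (x₀ D.idx.b) (x₀ D.idx.c) ν ≠ 0 →
        ∑ i, D.rWP (ξf x) i * ((xhat D.idx x₀ i : ℕ) : ℝ) < ∑ i, D.rWP (ξf x) i * (ν i : ℝ) :=
    fun x => D.sliceMin_of_visible hu hv hinj (ξf x) (hξval x) x.1 (hξtop x)
  choose xf hxπ hxa hxb hxc hxF hxmin using hpt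
  -- normalisation radii and the pencil parameter
  have hrpos : ∀ x : ↥S, 0 < -wt (ξf x) e₀ := fun x => by
    linarith [wt_enum_neg u v (ξf x) (hξval x) ⟨0, hsE⟩]
  have hnorm : ∀ x : ↥S, wt (fun k => ξf x k / (-wt (ξf x) e₀)) e₀ = -1 := fun x => by
    rw [wt_weight_div]
    have hne : wt (ξf x) e₀ ≠ 0 := by linarith [hrpos x]
    rw [div_neg, div_self hne]
  have hc : ∀ x : ↥S, ∃ c : ℝ, ∀ e : Expo, wt (fun k => ξf x k / (-wt (ξf x) e₀)) e = wt β e + c * wt τ e :=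
    fun x => hpencil _ (hnorm x)
  choose cf hcf using hc
  set U : Fin (sE u v) → ℝ := fun i => -wt β (D.enumP i) with hU
  set V : Fin (sE u v) → ℝ := fun i => -wt τ (D.enumP i) with hV
  have hUV : ∀ (x : ↥S) (i : Fin (sE u v)),
      U i + cf x * V i = D.rWP (ξf x) i / (-wt (ξf x) e₀) := fun x i => by
    have h := hcf x (D.enumP i)
    rw [wt_weight_div] at h
    rw [hU, hV]
    unfold RelData.rWP
    simp only
    rw [neg_div, h]
    ring
  have hsumUV : ∀ (x : ↥S) (ν : Fin (sE u v) → ℕ), ∑ i, (U i + cf x * V i) * (ν i : ℝ) =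
      (∑ i, D.rWP (ξf x) i * (ν i : ℝ)) / (-wt (ξf x) e₀) := fun x ν => by
    rw [Finset.sum_div]
    refine Finset.sum_congr rfl fun i _ => ?_
    rw [hUV x i]
    ring
  -- the key map `l ↦ ((b₁, b₂), x̂₀)` is injective
  set key : ↥S → (ℕ × ℕ) × (Fin (sE u v) → ℕ) :=
    fun x => ((xf x D.idx.b, xf x D.idx.c), ⇑(xhat D.idx (xf x))) with hkey
  have hinjK : Function.Injective key := by
    intro x y h
    rw [hkey] at h
    simp only [Prod.mk.injEq] at h
    have hx : xf x = xf y := by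
      rw [← xOf_xhat D.idx (xf x) (hxa x), ← xOf_xhat D.idx (xf y) (hxa y), h.1.1, h.1.2]
      exact congrArg _ h.2
    apply Subtype.ext
    exact nsmul_cancel D.hp (by rw [← hxπ x, ← hxπ y, hx])
  set Img : Finset ((ℕ × ℕ) × (Fin (sE u v) → ℕ)) := (Finset.univ : Finset ↥S).image key with hImg
  have hcard : Img.card = S.card := by
    rw [hImg, Finset.card_image_of_injective _ hinjK, Finset.card_univ, Fintype.card_coe]
  set Box : Finset (ℕ × ℕ) := Finset.range (2 * (m * m) + 1) ×ˢ Finset.range (2 * (m * m) + 1) with hBox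
  have hfst : ∀ p ∈ Img, p.1 ∈ Box := by
    intro p hp
    obtain ⟨x, -, rfl⟩ := Finset.mem_image.mp hp
    rw [hBox, Finset.mem_product, Finset.mem_range, Finset.mem_range]
    have h1 := hxb x
    have h2 := hxc x
    rw [hkey]
    simp only
    constructor <;> omega
  have hfib : ∀ bc ∈ Box, (Img.filter fun p => p.1 = bc).card ≤ sliceBd8 m (sE u v) := by
    intro bc hbc
    rw [hBox, Finset.mem_product, Finset.mem_range, Finset.mem_range] at hbc
    have hbsum : bc.1 + bc.2 ≤ 4 * (m * m) := by omega
    set Sb : Finset (Fin (sE u v) → ℕ) := (Img.filter fun p => p.1 = bc).image Prod.snd with hSb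
    have hcardb : (Img.filter fun p => p.1 = bc).card = Sb.card := by
      rw [hSb, Finset.card_image_of_injOn]
      intro p hp p' hp' hpq
      have h1 := (Finset.mem_filter.mp (Finset.mem_coe.mp hp)).2
      have h2 := (Finset.mem_filter.mp (Finset.mem_coe.mp hp')).2
      exact Prod.ext (h1.trans h2.symm) hpq
    rw [hcardb]
    refine sliceCount D bc.1 bc.2 hbsum U V Sb fun μ hμ => ?_
    obtain ⟨p, hp, rfl⟩ := Finset.mem_image.mp hμ
    obtain ⟨hpI, hpb⟩ := Finset.mem_filter.mp hp
    obtain ⟨x, -, rfl⟩ := Finset.mem_image.mp hpI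
    rw [hkey] at hpb ⊢
    simp only at hpb ⊢
    have hb1 : xf x D.idx.b = bc.1 := by rw [← hpb]
    have hb2 : xf x D.idx.c = bc.2 := by rw [← hpb]
    refine ⟨?_, cf x, fun ν hν hFν => ?_⟩
    · have := hxF x
      rw [hb1, hb2] at this
      exact this
    · have hFν' : Fsl D.idx (cU u v) (cV u v) (xf x D.idx.b) (xf x D.idx.c) ν ≠ 0 := by rw [hb1, hb2]; exact hFν
      have hlt := hxmin x ν hν hFν'
      rw [hsumUV x, hsumUV x ν]
      exact div_lt_div_of_pos_right hlt (hrpos x)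
  rw [← hcard, Finset.card_eq_sum_card_fiberwise hfst]
  calc ∑ bc ∈ Box, (Img.filter fun p => p.1 = bc).card
      ≤ ∑ bc ∈ Box, sliceBd8 m (sE u v) := Finset.sum_le_sum hfib
    _ = (2 * (m * m) + 1) * (2 * (m * m) + 1) * sliceBd8 m (sE u v) := by
        rw [Finset.sum_const, smul_eq_mul, hBox, Finset.card_product, Finset.card_range]

/-! ### Degenerate relation data are permutation type -/

/-- A `0`-filled letter tuple of length `m` uses every letter at most `m` times. [folklore] -/
theorem msetT_apply_le (a : Fin m → Expo) (e : Expo) : msetT a e ≤ m := by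
  classical
  unfold msetT
  rw [Finsupp.finsetSum_apply]
  calc ∑ j, ((if a j = 0 then (0 : Expo →₀ ℕ) else Finsupp.single (a j) 1) e)
      ≤ ∑ _j : Fin m, 1 := Finset.sum_le_sum fun j _ => by
        split_ifs with h
        · simp
        · rw [Finsupp.single_apply]; split_ifs <;> simp
    _ = m := by simp

/-- **Large coefficients are permutation type.** If the coincidences are rank one with relation `ρ⁺ ~ ρ⁻` and some letter has
coefficient `> m` on one side and `0` on the other, the family is of permutation type. [folklore] -/
theorem permType_of_rankOne_largeCoeff (A : Fin m → Finset Expo) (ρp ρm : Expo →₀ ℕ) (e : Expo)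
    (h : RankOneCoincidences A ρp ρm) (hl : (m < ρp e ∧ ρm e = 0) ∨ (m < ρm e ∧ ρp e = 0)) : PermType A := by
  intro a ha b hb hab
  obtain ⟨k, hk⟩ := h a ha b hb hab
  have hae := msetT_apply_le a e
  have hbe := msetT_apply_le b e
  rcases Nat.eq_zero_or_pos k with rfl | hk0
  · rcases hk with hk | hk
    · simpa using hk
    · simpa using hk.symm
  · exfalso
    rcases hk with hk | hk
    · have h1 := congrArg (fun f : Expo →₀ ℕ => f e) hk
      simp only [Finsupp.add_apply, Finsupp.smul_apply, smul_eq_mul] at h1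
      rcases hl with ⟨hp, hm0⟩ | ⟨hm, hp0⟩
      · rw [hm0, mul_zero, add_zero] at h1
        have : ρp e ≤ k * ρp e := Nat.le_mul_of_pos_left _ hk0
        omega
      · rw [hp0, mul_zero, add_zero] at h1
        have : ρm e ≤ k * ρm e := Nat.le_mul_of_pos_left _ hk0
        omega
    · have h1 := congrArg (fun f : Expo →₀ ℕ => f e) hk
      simp only [Finsupp.add_apply, Finsupp.smul_apply, smul_eq_mul] at h1
      rcases hl with ⟨hp, hm0⟩ | ⟨hm, hp0⟩
      · rw [hm0, mul_zero, add_zero] at h1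
        have : ρp e ≤ k * ρp e := Nat.le_mul_of_pos_left _ hk0
        omega
      · rw [hp0, mul_zero, add_zero] at h1
        have : ρm e ≤ k * ρm e := Nat.le_mul_of_pos_left _ hk0
        omega

/-- **Absent relation letters are permutation type.** If a letter with positive coefficient on one side of the relation (and `0`
on the other) is absent from the family, rank-one coincidences are of permutation type. [folklore] -/
theorem permType_of_rankOne_absent (A : Fin m → Finset Expo) (ρp ρm : Expo →₀ ℕ) (e : Expo)
    (h : RankOneCoincidences A ρp ρm) (hl : (0 < ρp e ∧ ρm e = 0) ∨ (0 < ρm e ∧ ρp e = 0)) (hnot : ∀ j, e ∉ A j) :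
    PermType A := by
  intro a ha b hb hab
  obtain ⟨k, hk⟩ := h a ha b hb hab
  have hae := msetT_apply_eq_zero A a ha e hnot
  have hbe := msetT_apply_eq_zero A b hb e hnot
  rcases Nat.eq_zero_or_pos k with rfl | hk0
  · rcases hk with hk | hk
    · simpa using hk
    · simpa using hk.symm
  · exfalso
    rcases hk with hk | hk
    · have h1 := congrArg (fun f : Expo →₀ ℕ => f e) hk
      simp only [Finsupp.add_apply, Finsupp.smul_apply, smul_eq_mul, hae, hbe, zero_add] at h1
      rcases hl with ⟨hp, hm0⟩ | ⟨hm, hp0⟩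
      · rw [hm0, mul_zero] at h1
        have : ρp e ≤ k * ρp e := Nat.le_mul_of_pos_left _ hk0
        omega
      · rw [hp0, mul_zero] at h1
        have : ρm e ≤ k * ρm e := Nat.le_mul_of_pos_left _ hk0
        omega
    · have h1 := congrArg (fun f : Expo →₀ ℕ => f e) hk
      simp only [Finsupp.add_apply, Finsupp.smul_apply, smul_eq_mul, hae, hbe, zero_add] at h1
      rcases hl with ⟨hp, hm0⟩ | ⟨hm, hp0⟩
      · rw [hm0, mul_zero] at h1
        have : ρp e ≤ k * ρp e := Nat.le_mul_of_pos_left _ hk0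
        omega
      · rw [hp0, mul_zero] at h1
        have : ρm e ≤ k * ρm e := Nat.le_mul_of_pos_left _ hk0
        omega

/-! ### The arithmetic (no `ring` on numeral powers of `s + 2`) -/

theorem Nm8_add_two_le (m : ℕ) (hm : 1 ≤ m) : Nm8 m + 2 ≤ 32 * (m + 1) ^ 5 := by
  unfold Nm8
  have e1 : (m + 1) ^ 2 = m * m + 2 * m + 1 := by ring
  have h1 : 4 * (m * m) + 1 ≤ 4 * (m + 1) ^ 2 := by rw [e1]; omega
  have h2 : (4 * (m * m) + 1) ^ 2 ≤ (4 * (m + 1) ^ 2) ^ 2 := Nat.pow_le_pow_left h1 2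
  have e3 : (4 * (m + 1) ^ 2) ^ 2 = 16 * (m + 1) ^ 4 := by ring
  rw [e3] at h2
  have h4 : 2 * m * (4 * (m * m) + 1) ^ 2 ≤ 2 * m * (16 * (m + 1) ^ 4) := Nat.mul_le_mul_left _ h2
  have e5 : 32 * (m + 1) ^ 5 = 2 * m * (16 * (m + 1) ^ 4) + 32 * (m + 1) ^ 4 := by ring
  have h6 : 1 ≤ (m + 1) ^ 4 := Nat.one_le_pow _ _ (by omega)
  rw [e5]
  omega

theorem Nm8_add_two_lt (m : ℕ) (hm : 1 ≤ m) : Nm8 m + 2 < 2 ^ (5 * Nat.log 2 (m + 1) + 10) := by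
  have hp1 : m + 1 < 2 ^ (Nat.log 2 (m + 1) + 1) := Nat.lt_pow_succ_log_self (by norm_num) (m + 1)
  have h5 : (m + 1) ^ 5 < (2 ^ (Nat.log 2 (m + 1) + 1)) ^ 5 := Nat.pow_lt_pow_left hp1 (by norm_num)
  have e3 : 32 * (2 ^ (Nat.log 2 (m + 1) + 1)) ^ 5 = 2 ^ (5 * Nat.log 2 (m + 1) + 10) := by
    rw [← pow_mul, show (32 : ℕ) = 2 ^ 5 by norm_num, ← pow_add]
    congr 1
    ring
  have h1 := Nm8_add_two_le m hm
  have h8 : 32 * (m + 1) ^ 5 < 32 * (2 ^ (Nat.log 2 (m + 1) + 1)) ^ 5 := Nat.mul_lt_mul_of_pos_left h5 (by norm_num)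
  omega

theorem logNm8_le (m : ℕ) (hm : 1 ≤ m) : Nat.log 2 (Nm8 m + 2) + 1 ≤ 5 * Nat.log 2 (m + 1) + 10 := by
  have := Nat.log_lt_of_lt_pow (by omega : Nm8 m + 2 ≠ 0) (Nm8_add_two_lt m hm)
  omega

theorem sqlog8_le (m : ℕ) (hm : 1 ≤ m) :
    (5 * Nat.log 2 (m + 1) + 10) * (5 * Nat.log 2 (m + 1) + 10) ≤ 300 * m := by
  have hp2 : 2 ^ Nat.log 2 (m + 1) ≤ m + 1 := Nat.pow_log_le_self 2 (by omega)
  have hpp : Nat.log 2 (m + 1) < 2 ^ Nat.log 2 (m + 1) := Nat.lt_two_pow_self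
  have hp3 : Nat.log 2 (m + 1) * Nat.log 2 (m + 1) ≤ 2 ^ (Nat.log 2 (m + 1) + 1) := sq_le_two_pow_succ _
  have h2p : 2 ^ (Nat.log 2 (m + 1) + 1) = 2 * 2 ^ Nat.log 2 (m + 1) := pow_succ' 2 _
  have e4 : (5 * Nat.log 2 (m + 1) + 10) * (5 * Nat.log 2 (m + 1) + 10) =
      25 * (Nat.log 2 (m + 1) * Nat.log 2 (m + 1)) + 100 * Nat.log 2 (m + 1) + 100 := by ring
  rw [e4]
  omega

theorem powNm8_le (m : ℕ) (hm : 1 ≤ m) : (Nm8 m + 2) ^ (3 * (Nat.log 2 (Nm8 m + 2) + 1)) ≤ 2 ^ (900 * m) := by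
  have hN2 := Nm8_add_two_lt m hm
  have hL := logNm8_le m hm
  have hq := sqlog8_le m hm
  calc (Nm8 m + 2) ^ (3 * (Nat.log 2 (Nm8 m + 2) + 1))
      ≤ (2 ^ (5 * Nat.log 2 (m + 1) + 10)) ^ (3 * (Nat.log 2 (Nm8 m + 2) + 1)) := Nat.pow_le_pow_left hN2.le _
    _ ≤ (2 ^ (5 * Nat.log 2 (m + 1) + 10)) ^ (3 * (5 * Nat.log 2 (m + 1) + 10)) :=
        Nat.pow_le_pow_right (by positivity) (Nat.mul_le_mul_left _ hL)
    _ = 2 ^ (3 * ((5 * Nat.log 2 (m + 1) + 10) * (5 * Nat.log 2 (m + 1) + 10))) := by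
        rw [← pow_mul]
        congr 1
        ring
    _ ≤ 2 ^ (900 * m) := Nat.pow_le_pow_right (by norm_num) (by omega)

theorem slices_le8 (m : ℕ) (hm : 1 ≤ m) : (2 * (m * m) + 1) * (2 * (m * m) + 1) ≤ 2 ^ (6 * m) := by
  have hm1 : m + 1 ≤ 2 ^ m := Nat.lt_two_pow_self
  have e1 : (m + 1) * (m + 1) = m * m + 2 * m + 1 := by ring
  have h1 : 2 * (m * m) + 1 ≤ 2 * ((m + 1) * (m + 1)) := by rw [e1]; omega
  have h2 : (m + 1) * (m + 1) ≤ 2 ^ m * 2 ^ m := Nat.mul_le_mul hm1 hm1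
  have h3 : 2 * (m * m) + 1 ≤ 2 * (2 ^ m * 2 ^ m) := h1.trans (Nat.mul_le_mul_left _ h2)
  have e2 : 2 * (2 ^ m * 2 ^ m) * (2 * (2 ^ m * 2 ^ m)) = 2 ^ (4 * m + 2) := by
    rw [show 2 * (2 ^ m * 2 ^ m) = 2 ^ (2 * m + 1) by
      rw [pow_succ, ← pow_add, show m + m = 2 * m by ring]; ring]
    rw [← pow_add]
    congr 1
    ring
  have h4 : 2 ^ (4 * m + 2) ≤ 2 ^ (6 * m) := Nat.pow_le_pow_right (by norm_num) (by omega)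
  calc (2 * (m * m) + 1) * (2 * (m * m) + 1) ≤ 2 * (2 ^ m * 2 ^ m) * (2 * (2 ^ m * 2 ^ m)) := Nat.mul_le_mul h3 h3
    _ = 2 ^ (4 * m + 2) := e2
    _ ≤ 2 ^ (6 * m) := h4

set_option exponentiation.threshold 2048 in
/-- **Arithmetic**: `(2m²+1)² · sliceBd8 ≤ 2^{c m} (s+2)^c` and `2^{13m}(s+2)^2 ≤ 2^{c m}(s+2)^c` with `c = 906`. [folklore] -/
theorem arith_R7b : ∃ c : ℕ,
    (∀ m s : ℕ, 1 ≤ m → (2 * (m * m) + 1) * (2 * (m * m) + 1) * sliceBd8 m s ≤ 2 ^ (c * m) * (s + 2) ^ c) ∧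
    (∀ m s : ℕ, 2 ^ (13 * m) * (s + 2) ^ 2 ≤ 2 ^ (c * m) * (s + 2) ^ c) := by
  refine ⟨906, fun m s hm => ?_, fun m s => ?_⟩
  · have hsl := slices_le8 m hm
    have hsA : (s + 2) ^ 3 ≤ (s + 2) ^ 906 := Nat.pow_le_pow_right (by omega) (by norm_num)
    have hpow := powNm8_le m hm
    have h2m : 2 ^ (6 * m) * 2 ^ (900 * m) ≤ 2 ^ (906 * m) := by
      rw [← pow_add]
      exact Nat.pow_le_pow_right (by norm_num) (by omega)
    unfold sliceBd8
    calc (2 * (m * m) + 1) * (2 * (m * m) + 1) * ((s + 2) ^ 3 * (Nm8 m + 2) ^ (3 * (Nat.log 2 (Nm8 m + 2) + 1)))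
        ≤ 2 ^ (6 * m) * ((s + 2) ^ 906 * 2 ^ (900 * m)) := Nat.mul_le_mul hsl (Nat.mul_le_mul hsA hpow)
      _ = 2 ^ (6 * m) * 2 ^ (900 * m) * (s + 2) ^ 906 := by
          rw [Nat.mul_comm ((s + 2) ^ 906) (2 ^ (900 * m)), ← Nat.mul_assoc]
      _ ≤ 2 ^ (906 * m) * (s + 2) ^ 906 := Nat.mul_le_mul_right _ h2m
  · exact Nat.mul_le_mul (Nat.pow_le_pow_right (by norm_num) (by omega))
      (Nat.pow_le_pow_right (by omega) (by norm_num))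

/-- **R7b — the general three-letter rank-one law (all coefficients `p, q, r ≥ 1`).** If ALL additive coincidences of the letter
family come from ONE relation `p α = q β + r γ` among distinct letters (rank-one coincidence lattice), then GLOBALLY
`#visible ≤ 2^{c m} (#T + 2)^c`.  `p = 1` is R7a (`RankOneThreeFreeLaw`), `(p;q,r) = (1;1,1)` R6b, `(2;1,1)` R6c (letters renamed),
`p = q + r` R6d. [folklore] -/
def RankOneThreeGenLaw : Prop :=
  ∃ c : ℕ, ∀ (m : ℕ) (u v : Fin m → MvPolynomial (Fin 2) ℂ), (∀ j, coeff 0 (u j) = 0) → (∀ j, coeff 0 (v j) = 0) →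
    (∃ (α β γ : Expo) (p q r : ℕ), 1 ≤ p ∧ 1 ≤ q ∧ 1 ≤ r ∧ α ≠ β ∧ α ≠ γ ∧ β ≠ γ ∧ p • α = q • β + r • γ ∧
      RankOneCoincidences (fun j => (u j).support ∪ (v j).support)
        (Finsupp.single β q + Finsupp.single γ r) (Finsupp.single α p)) →
    ∀ S : Finset Expo, (∀ l ∈ S, ∃ ξ : Fin 2 → ℝ, ValidWeight u v ξ ∧ IsStrictTop ξ ↑(tailDiff u v).support l) →
      S.card ≤ 2 ^ (c * m) * ((tailSupport u v).card + 2) ^ c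

/-- **R7b PROVED UNCONDITIONALLY** (lift `α ↦ β^q γ^r, β ↦ β^p, γ ↦ γ^p` over the `p`-dilated plane + toric Lemma A + DOUBLE slicing
with divisibility guards + coefficient theorem + finite shift rank + val-lit-p3's `ShiftRank.pencilCount`; large or absent
coefficients are permutation type). [folklore] -/
theorem rankOneThreeGenLaw : RankOneThreeGenLaw := by
  classical
  obtain ⟨c, hc1, hc2⟩ := arith_R7b
  refine ⟨c, fun m u v hu hv hrel S hS => ?_⟩
  obtain ⟨α, β, γ, p, q, r, hp, hq, hr, hab, hac, hbc, hrel, hR⟩ := hrel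
  rcases S.eq_empty_or_nonempty with hSe | hSne
  · simp [hSe]
  obtain ⟨l₀, hl₀⟩ := hSne
  obtain ⟨ξ₀, hval₀, htop₀⟩ := hS l₀ hl₀
  have hm : 1 ≤ m := by
    rcases Nat.eq_zero_or_pos m with h | h
    · exfalso
      subst h
      apply mem_support_iff.mp htop₀.1
      unfold tailDiff
      simp
    · exact h
  -- evaluations of the relation sides at the three letters
  have hρpα : (Finsupp.single β q + Finsupp.single γ r) α = 0 := by
    simp [Finsupp.single_apply, Ne.symm hab, Ne.symm hac]
  have hρmα : (Finsupp.single α p : Expo →₀ ℕ) α = p := by simp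
  have hρpβ : (Finsupp.single β q + Finsupp.single γ r) β = q := by
    simp [Finsupp.single_apply, Ne.symm hbc]
  have hρmβ : (Finsupp.single α p : Expo →₀ ℕ) β = 0 := by simp [Finsupp.single_apply, hab]
  have hρpγ : (Finsupp.single β q + Finsupp.single γ r) γ = r := by
    simp [Finsupp.single_apply, hbc]
  have hρmγ : (Finsupp.single α p : Expo →₀ ℕ) γ = 0 := by simp [Finsupp.single_apply, hac]
  have hPT : PermType (fun j => (u j).support ∪ (v j).support) →
      S.card ≤ 2 ^ (c * m) * ((tailSupport u v).card + 2) ^ c := fun hperm =>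
    calc S.card ≤ 2 ^ (13 * m) * ((tailSupport u v).card + 2) ^ 2 := permTypeLaw_proof m u v hu hv hperm S hS
      _ ≤ 2 ^ (c * m) * ((tailSupport u v).card + 2) ^ c := hc2 m _
  by_cases hlarge : m < q ∨ m < r ∨ m < p
  · -- a coefficient exceeds `m`: permutation type
    apply hPT
    rcases hlarge with hql | hrl | hpl
    · exact permType_of_rankOne_largeCoeff _ _ _ β hR (Or.inl ⟨by rw [hρpβ]; exact hql, hρmβ⟩)
    · exact permType_of_rankOne_largeCoeff _ _ _ γ hR (Or.inl ⟨by rw [hρpγ]; exact hrl, hρmγ⟩)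
    · exact permType_of_rankOne_largeCoeff _ _ _ α hR (Or.inr ⟨by rw [hρmα]; exact hpl, hρpα⟩)
  have hqm : q ≤ m := by omega
  have hrm : r ≤ m := by omega
  have hpm : p ≤ m := by omega
  by_cases hall : α ∈ tailSupport u v ∧ β ∈ tailSupport u v ∧ γ ∈ tailSupport u v
  · obtain ⟨hα, hβ, hγ⟩ := hall
    let D : RelData u v := ⟨α, β, γ, q, r, p, hq, hp, hα, hβ, hγ, hab, hac, hbc, hrel⟩
    have h := (D.count hu hv hqm hrm hpm hR S hS).trans (hc1 m (sE u v) hm)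
    exact h
  · -- an absent relation letter: permutation type
    apply hPT
    have hex : ∃ e : Expo, (e = α ∨ e = β ∨ e = γ) ∧ e ∉ tailSupport u v := by
      simp only [not_and_or] at hall
      rcases hall with h | h | h
      exacts [⟨α, Or.inl rfl, h⟩, ⟨β, Or.inr (Or.inl rfl), h⟩, ⟨γ, Or.inr (Or.inr rfl), h⟩]
    obtain ⟨e, he, hnot⟩ := hex
    have hnotj : ∀ j, e ∉ (u j).support ∪ (v j).support := by
      intro j hj
      apply hnot
      rcases Finset.mem_union.mp hj with h | h
      · exact support_u_subset u v j h
      · exact support_v_subset u v j h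
    rcases he with rfl | rfl | rfl
    · exact permType_of_rankOne_absent _ _ _ e hR (Or.inr ⟨by rw [hρmα]; exact hp, hρpα⟩) hnotj
    · exact permType_of_rankOne_absent _ _ _ e hR (Or.inl ⟨by rw [hρpβ]; exact hq, hρmβ⟩) hnotj
    · exact permType_of_rankOne_absent _ _ _ e hR (Or.inl ⟨by rw [hρpγ]; exact hr, hρmγ⟩) hnotj

/-! ### Corollaries: the earlier three-letter rungs are instances -/

/-- Rank-one coincidences are symmetric in the two sides of the relation. [folklore] -/
theorem rankOne_symm (A : Fin m → Finset Expo) (ρp ρm : Expo →₀ ℕ) (h : RankOneCoincidences A ρp ρm) :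
    RankOneCoincidences A ρm ρp := by
  intro a ha b hb hab
  obtain ⟨k, hk⟩ := h a ha b hb hab
  exact ⟨k, hk.symm.imp Eq.symm Eq.symm⟩

/-- `p = 1`: R7a's hypothesis shape (`α = qβ + rγ`, `RankOneCoincidences A (qβ + rγ) (α)`). [folklore] -/
theorem visible_bound_free (c : ℕ) (hc : ∀ (m : ℕ) (u v : Fin m → MvPolynomial (Fin 2) ℂ), (∀ j, coeff 0 (u j) = 0) →
      (∀ j, coeff 0 (v j) = 0) →
      (∃ (α β γ : Expo) (p q r : ℕ), 1 ≤ p ∧ 1 ≤ q ∧ 1 ≤ r ∧ α ≠ β ∧ α ≠ γ ∧ β ≠ γ ∧ p • α = q • β + r • γ ∧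
        RankOneCoincidences (fun j => (u j).support ∪ (v j).support)
          (Finsupp.single β q + Finsupp.single γ r) (Finsupp.single α p)) →
      ∀ S : Finset Expo, (∀ l ∈ S, ∃ ξ : Fin 2 → ℝ, ValidWeight u v ξ ∧ IsStrictTop ξ ↑(tailDiff u v).support l) →
        S.card ≤ 2 ^ (c * m) * ((tailSupport u v).card + 2) ^ c)
    (m : ℕ) (u v : Fin m → MvPolynomial (Fin 2) ℂ) (hu : ∀ j, coeff 0 (u j) = 0) (hv : ∀ j, coeff 0 (v j) = 0)
    (h : ∃ (α β γ : Expo) (q r : ℕ), 1 ≤ q ∧ 1 ≤ r ∧ α ≠ β ∧ α ≠ γ ∧ β ≠ γ ∧ α = q • β + r • γ ∧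
      RankOneCoincidences (fun j => (u j).support ∪ (v j).support)
        (Finsupp.single β q + Finsupp.single γ r) (Finsupp.single α 1))
    (S : Finset Expo) (hS : ∀ l ∈ S, ∃ ξ : Fin 2 → ℝ, ValidWeight u v ξ ∧ IsStrictTop ξ ↑(tailDiff u v).support l) :
    S.card ≤ 2 ^ (c * m) * ((tailSupport u v).card + 2) ^ c := by
  obtain ⟨α, β, γ, q, r, hq, hr, hab, hac, hbc, hrel, hR⟩ := h
  exact hc m u v hu hv ⟨α, β, γ, 1, q, r, le_refl 1, hq, hr, hab, hac, hbc, by rw [one_nsmul]; exact hrel, hR⟩ S hS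

/-- `p = q + r` (homogeneous, val-lit-p3 g15's R6d shape `qα' + rγ' = (q+r)β'`, `RankOneCoincidences A ((q+r)β') (qα' + rγ')`):
an instance with the roles `α ↦ β', β ↦ α', γ ↦ γ'`. [folklore] -/
theorem visible_bound_hom (c : ℕ) (hc : ∀ (m : ℕ) (u v : Fin m → MvPolynomial (Fin 2) ℂ), (∀ j, coeff 0 (u j) = 0) →
      (∀ j, coeff 0 (v j) = 0) →
      (∃ (α β γ : Expo) (p q r : ℕ), 1 ≤ p ∧ 1 ≤ q ∧ 1 ≤ r ∧ α ≠ β ∧ α ≠ γ ∧ β ≠ γ ∧ p • α = q • β + r • γ ∧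
        RankOneCoincidences (fun j => (u j).support ∪ (v j).support)
          (Finsupp.single β q + Finsupp.single γ r) (Finsupp.single α p)) →
      ∀ S : Finset Expo, (∀ l ∈ S, ∃ ξ : Fin 2 → ℝ, ValidWeight u v ξ ∧ IsStrictTop ξ ↑(tailDiff u v).support l) →
        S.card ≤ 2 ^ (c * m) * ((tailSupport u v).card + 2) ^ c)
    (m : ℕ) (u v : Fin m → MvPolynomial (Fin 2) ℂ) (hu : ∀ j, coeff 0 (u j) = 0) (hv : ∀ j, coeff 0 (v j) = 0)
    (h : ∃ α β γ : Expo, ∃ q r : ℕ, α ≠ β ∧ α ≠ γ ∧ β ≠ γ ∧ 1 ≤ q ∧ 1 ≤ r ∧ q • α + r • γ = (q + r) • β ∧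
      RankOneCoincidences (fun j => (u j).support ∪ (v j).support)
        (Finsupp.single β (q + r)) (Finsupp.single α q + Finsupp.single γ r))
    (S : Finset Expo) (hS : ∀ l ∈ S, ∃ ξ : Fin 2 → ℝ, ValidWeight u v ξ ∧ IsStrictTop ξ ↑(tailDiff u v).support l) :
    S.card ≤ 2 ^ (c * m) * ((tailSupport u v).card + 2) ^ c := by
  obtain ⟨α, β, γ, q, r, hab, hac, hbc, hq, hr, hrel, hR⟩ := h
  exact hc m u v hu hv ⟨β, α, γ, q + r, q, r, by omega, hq, hr, Ne.symm hab, hbc, hac, hrel.symm, rankOne_symm _ _ _ hR⟩ S hS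

/-! ### Rung R7c: rank one on TWO letters with torsion `p α = q β` — the `r = 0` instance with an idle third letter -/

/-- Planar support points of the difference of products are sums of letter tuples of the family. [folklore] -/
theorem exists_tuple_of_mem_support_tailDiff (hu : ∀ j, coeff 0 (u j) = 0) (hv : ∀ j, coeff 0 (v j) = 0) (n : Expo)
    (hn : n ∈ (tailDiff u v).support) :
    ∃ a ∈ tuples (fun j => (u j).support ∪ (v j).support), ∑ j, a j = n := by
  classical
  set A : Fin m → Finset Expo := fun j => (u j).support ∪ (v j).support with hA
  have hcU : ∀ j i, cU u v j i ≠ 0 → enum u v i ∈ A j := fun j i h =>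
    Finset.mem_union_left _ (mem_support_iff.mpr h)
  have hcV : ∀ j i, cV u v j i ≠ 0 → enum u v i ∈ A j := fun j i h =>
    Finset.mem_union_right _ (mem_support_iff.mpr h)
  have hn' : n ∈ (phi (enum u v) (liftG (cU u v) (cV u v))).support := by
    rw [phi_liftG]; exact hn
  obtain ⟨κ, hκ, hπ⟩ := exists_of_mem_support_phi (enum u v) _ n hn'
  unfold liftG at hκ
  rcases Finset.mem_union.1 (support_sub _ _ _ hκ) with h | h
  · obtain ⟨a, ha, hs, -⟩ := tuple_of_mem_support_prod u v hu hv A (cU u v) hcU κ h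
    exact ⟨a, ha, hs.trans hπ⟩
  · obtain ⟨a, ha, hs, -⟩ := tuple_of_mem_support_prod u v hu hv A (cV u v) hcV κ h
    exact ⟨a, ha, hs.trans hπ⟩

/-- A tail alphabet inside `{α, β}`: at most `3^m` letter tuples, hence at most `3^m` support points. [folklore] -/
theorem card_le_of_subset_pair (hu : ∀ j, coeff 0 (u j) = 0) (hv : ∀ j, coeff 0 (v j) = 0) (α β : Expo)
    (hT : tailSupport u v ⊆ {α, β}) (S : Finset Expo) (hS : ∀ l ∈ S, l ∈ (tailDiff u v).support) :
    S.card ≤ 3 ^ m := by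
  classical
  set A : Fin m → Finset Expo := fun j => (u j).support ∪ (v j).support with hA
  have hAj : ∀ j, A j ⊆ {α, β} := fun j e he => by
    apply hT
    rcases Finset.mem_union.1 he with h | h
    · exact support_u_subset u v j h
    · exact support_v_subset u v j h
  have himg : S ⊆ (tuples A).image (fun a => ∑ j, a j) := fun l hl => by
    obtain ⟨a, ha, hsum⟩ := exists_tuple_of_mem_support_tailDiff hu hv l (hS l hl)
    exact Finset.mem_image.2 ⟨a, ha, hsum⟩
  have h2 : ({α, β} : Finset Expo).card ≤ 2 := Finset.card_le_two
  have h3 : ∀ j, (insert (0 : Expo) (A j)).card ≤ 3 := fun j =>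
    (Finset.card_insert_le _ _).trans (by have := (Finset.card_le_card (hAj j)).trans h2; omega)
  calc S.card ≤ ((tuples A).image fun a => ∑ j, a j).card := Finset.card_le_card himg
    _ ≤ (tuples A).card := Finset.card_image_le
    _ = ∏ j, (insert (0 : Expo) (A j)).card := by unfold tuples; exact Fintype.card_piFinset _
    _ ≤ ∏ _j : Fin m, 3 := Finset.prod_le_prod (fun _ _ => Nat.zero_le _) fun j _ => h3 j
    _ = 3 ^ m := by simp

/-- **R7c — rank one on TWO letters with torsion.** If ALL additive coincidences of the letter family come from ONE relation
`p α = q β` between two distinct letters (`p, q ≥ 1`; `p = q` is vacuous), then GLOBALLY `#visible ≤ 2^{c m} (#T + 2)^c`. [folklore] -/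
def RankOneTwoLaw : Prop :=
  ∃ c : ℕ, ∀ (m : ℕ) (u v : Fin m → MvPolynomial (Fin 2) ℂ), (∀ j, coeff 0 (u j) = 0) → (∀ j, coeff 0 (v j) = 0) →
    (∃ (α β : Expo) (p q : ℕ), 1 ≤ p ∧ 1 ≤ q ∧ α ≠ β ∧ p • α = q • β ∧
      RankOneCoincidences (fun j => (u j).support ∪ (v j).support) (Finsupp.single β q) (Finsupp.single α p)) →
    ∀ S : Finset Expo, (∀ l ∈ S, ∃ ξ : Fin 2 → ℝ, ValidWeight u v ξ ∧ IsStrictTop ξ ↑(tailDiff u v).support l) →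
      S.card ≤ 2 ^ (c * m) * ((tailSupport u v).card + 2) ^ c

/-- **R7c PROVED UNCONDITIONALLY**: the `r = 0` instance of the R7b engine with ANY third tail letter `γ` as an idle dummy
(`Y_γ ↦ Y_γ^p`, `enumP γ = γ`); large or absent coefficients/letters are permutation type; a tail alphabet inside `{α, β}` has at
most `3^m ≤ 2^{13 m}` visible points. [folklore] -/
theorem rankOneTwoLaw : RankOneTwoLaw := by
  classical
  obtain ⟨c, hc1, hc2⟩ := arith_R7b
  refine ⟨c, fun m u v hu hv hrel S hS => ?_⟩
  obtain ⟨α, β, p, q, hp, hq, hab, hrel, hR⟩ := hrel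
  rcases S.eq_empty_or_nonempty with hSe | hSne
  · simp [hSe]
  obtain ⟨l₀, hl₀⟩ := hSne
  obtain ⟨ξ₀, hval₀, htop₀⟩ := hS l₀ hl₀
  have hm : 1 ≤ m := by
    rcases Nat.eq_zero_or_pos m with h | h
    · exfalso
      subst h
      apply mem_support_iff.mp htop₀.1
      unfold tailDiff
      simp
    · exact h
  have hρpα : (Finsupp.single β q : Expo →₀ ℕ) α = 0 := by simp [Finsupp.single_apply, Ne.symm hab]
  have hρmα : (Finsupp.single α p : Expo →₀ ℕ) α = p := by simp
  have hρpβ : (Finsupp.single β q : Expo →₀ ℕ) β = q := by simp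
  have hρmβ : (Finsupp.single α p : Expo →₀ ℕ) β = 0 := by simp [Finsupp.single_apply, hab]
  have hPT : PermType (fun j => (u j).support ∪ (v j).support) →
      S.card ≤ 2 ^ (c * m) * ((tailSupport u v).card + 2) ^ c := fun hperm =>
    calc S.card ≤ 2 ^ (13 * m) * ((tailSupport u v).card + 2) ^ 2 := permTypeLaw_proof m u v hu hv hperm S hS
      _ ≤ 2 ^ (c * m) * ((tailSupport u v).card + 2) ^ c := hc2 m _
  by_cases hlarge : m < q ∨ m < p
  · apply hPT
    rcases hlarge with hql | hpl
    · exact permType_of_rankOne_largeCoeff _ _ _ β hR (Or.inl ⟨by rw [hρpβ]; exact hql, hρmβ⟩)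
    · exact permType_of_rankOne_largeCoeff _ _ _ α hR (Or.inr ⟨by rw [hρmα]; exact hpl, hρpα⟩)
  have hqm : q ≤ m := by omega
  have hpm : p ≤ m := by omega
  have habsent : ∀ e : Expo, (e = α ∨ e = β) → e ∉ tailSupport u v →
      PermType (fun j => (u j).support ∪ (v j).support) := by
    intro e he hnot
    have hnotj : ∀ j, e ∉ (u j).support ∪ (v j).support := by
      intro j hj
      apply hnot
      rcases Finset.mem_union.mp hj with h | h
      · exact support_u_subset u v j h
      · exact support_v_subset u v j h
    rcases he with rfl | rfl
    · exact permType_of_rankOne_absent _ _ _ e hR (Or.inr ⟨by rw [hρmα]; exact hp, hρpα⟩) hnotj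
    · exact permType_of_rankOne_absent _ _ _ e hR (Or.inl ⟨by rw [hρpβ]; exact hq, hρmβ⟩) hnotj
  by_cases hαT : α ∈ tailSupport u v
  swap
  · exact hPT (habsent α (Or.inl rfl) hαT)
  by_cases hβT : β ∈ tailSupport u v
  swap
  · exact hPT (habsent β (Or.inr rfl) hβT)
  by_cases h3 : ∃ γ ∈ tailSupport u v, γ ≠ α ∧ γ ≠ β
  · -- an idle third tail letter: the `r = 0` instance of the engine
    obtain ⟨γ, hγ, hca, hcb⟩ := h3
    let D : RelData u v := ⟨α, β, γ, q, 0, p, hq, hp, hαT, hβT, hγ, hab, Ne.symm hca, Ne.symm hcb,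
      by rw [zero_nsmul, add_zero]; exact hrel⟩
    have hR' : RankOneCoincidences (fun j => (u j).support ∪ (v j).support)
        (Finsupp.single D.β D.q + Finsupp.single D.γ D.r) (Finsupp.single D.α D.p) := by
      show RankOneCoincidences _ (Finsupp.single β q + Finsupp.single γ 0) (Finsupp.single α p)
      rw [Finsupp.single_zero, add_zero]
      exact hR
    have h := (D.count hu hv hqm (Nat.zero_le m) hpm hR' S hS).trans (hc1 m (sE u v) hm)
    exact h
  · -- the tail alphabet lies inside `{α, β}`
    have hT : tailSupport u v ⊆ {α, β} := by
      intro e he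
      rw [Finset.mem_insert, Finset.mem_singleton]
      by_contra hne
      push Not at hne
      exact h3 ⟨e, he, hne.1, hne.2⟩
    have h1 := card_le_of_subset_pair hu hv α β hT S fun l hl => by
      obtain ⟨ξ, -, htop⟩ := hS l hl
      exact Finset.mem_coe.1 htop.1
    have h34 : 3 ^ m ≤ 2 ^ (13 * m) := by
      calc 3 ^ m ≤ 4 ^ m := Nat.pow_le_pow_left (by norm_num) m
        _ = 2 ^ (2 * m) := by rw [pow_mul]; norm_num
        _ ≤ 2 ^ (13 * m) := Nat.pow_le_pow_right (by norm_num) (by omega)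
    have hs1 : 1 ≤ ((tailSupport u v).card + 2) ^ 2 := Nat.one_le_pow _ _ (by omega)
    calc S.card ≤ 3 ^ m := h1
      _ ≤ 2 ^ (13 * m) * ((tailSupport u v).card + 2) ^ 2 := by
          calc 3 ^ m ≤ 2 ^ (13 * m) * 1 := by rw [mul_one]; exact h34
            _ ≤ 2 ^ (13 * m) * ((tailSupport u v).card + 2) ^ 2 := Nat.mul_le_mul_left _ hs1
      _ ≤ 2 ^ (c * m) * ((tailSupport u v).card + 2) ^ c := hc2 m _

end FreeCount

end R7b
end Summit.ValiantsHypothesis.ValiantsHypothesis.Theorems.NewtonUnitEquations.TwoProducts.PermutationType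

end
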